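import Summits.HodgeConjecture.HodgeConjecture.Theorems.F0P3cStCharTSDatumJunction4   -- ★ p851562 (LH6-p01) «DATUM-JUNCTION v4»: BODY ⟸ 59 hypotheses (brings the organ's vocabulary and every ★ slice it folds)
import Summits.HodgeConjecture.HodgeConjecture.Theorems.F0P3cStCharTSDatumWitness     -- ★ p851368 (LH6-p01) WITNESS: `exists_datum_with_fields`
import Summits.HodgeConjecture.HodgeConjecture.Theorems.F0P3cStCharTSCharField        -- ★ p851211 (LH6-p01) S1: `exists_charFamily_charRegularity_Gqs`
import Summits.HodgeConjecture.HodgeConjecture.Theorems.F0P3cStCharTSDGField          -- ★ p851395 (LH4-p02) DG-FIELD: formula pins `measurable_DG`, `DG_eq_zero_or_le`, `DG_coe_torus_eq_of_unit_rel`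
import Summits.HodgeConjecture.HodgeConjecture.Theorems.F0P3cStCharTSDGFieldTwo       -- ★ p851405 (F0P3-p02) DG-FIELD-TWO: `exists_DG_field_two`
import Summits.HodgeConjecture.HodgeConjecture.Theorems.F0P3cStCharTSStPin            -- ★ p851514 (F0P2-p06) ST-PIN: `exists_stDetFields`
import Summits.HodgeConjecture.HodgeConjecture.Theorems.F0P3cStCharTSXiSurj           -- ★ p851549 (LH6-p03) XI-SURJ ∕ KEYS-PAIRS: `exists_keysFields_Hv_pairs`
import Summits.HodgeConjecture.HodgeConjecture.Theorems.F0P3cStCharTSHFieldsHcb       -- ★ p851509 (F0P2-p01) H-FIELDS-HCB: `exists_charSt_packetCharHRegularity_hcb`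
import Summits.HodgeConjecture.HodgeConjecture.Theorems.F0P3cStCharTSParFieldW        -- ★ p851474 (LH6-p03) PAR-FIELD-W: `exists_parField_W`
import Summits.HodgeConjecture.HodgeConjecture.Theorems.F0P3cStCharTSHcbH             -- ★ p851449 (F0P3-p02) `hHBH_of_compactBound`, `hHBH_cartanH_of_compactBound`
import Summits.HodgeConjecture.HodgeConjecture.Theorems.F0P3cStCharTSOrbit            -- ★ p851442 (LH6-p03) ORBIT: `isConstituentOf_iff_of_common_constituent`
import Summits.HodgeConjecture.HodgeConjecture.Theorems.F0P3cStCharTSStJH             -- ★ p851573 (F0P2-p06) ST-JH: `stJH_datum`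
import Summits.HodgeConjecture.HodgeConjecture.Theorems.F0P3cStCharTSCartanNullDischarge  -- ★ p851428 (F0P3-p04): `isFiniteMeasure_of_compact_haar`, `rootKernels_of_compact_centralizers`
import Literature.NumberTheory.Rogawski1990.ShalikaGermHomogeneityNonsplit             -- ★ p851627 (LH4-p03) GERM-RESIDUE letter: `ShalikaGermResidueAtTorus` (+ `_iff`)
import Summits.HodgeConjecture.HodgeConjecture.Theorems.F0P3cStCharTSDHLc             -- ★ p851612 (F0P3-p02) DH-LC: `DG₂_eq_dgFormulaTwo` (the rank-2 closed formula from the two letters)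
import Summits.HodgeConjecture.HodgeConjecture.Theorems.F0P3cStCharTSHstabHolds       -- ★ p851812 (F0P3-p04) ST-STABLE-H: `hstab_holds` (the outer `hstab` of v1–v3 is a theorem)
import Literature.NumberTheory.Rogawski1990.SemilocalQuadraticCharExtension          -- ★ `isQuadraticCharExtension_semilocalComponent_of_baseChange_eq` (the outer `hμq` of v1–v3 is a theorem)
import Summits.HodgeConjecture.HodgeConjecture.Theorems.F0P3cStCharTSRung0Cartan       -- ★ (this seat) INSTANTIATE-CARTAN: `exists_cartanInputs`
import Summits.HodgeConjecture.HodgeConjecture.Theorems.F0P3cStCharTSLdsTwoOfTwo       -- ★ p852080 (LH6-p02 g7) LDS-TWO-OF-TWO: `ldsTwo_of_ldsReducibleTwo` (hLdsTwo ⟸ «two distinct constituents»)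
import Summits.HodgeConjecture.HodgeConjecture.Theorems.F0P3cStCharTSWeylDiscrLocInt     -- ★ p852311 (F0P2-p01 g23, ROAD HC-D) `locallyIntegrable_weylDiscr_inv` : `|D_G|^{-1∕2} ∈ L¹_loc(Gqs L v)` — the outer (HC-D) of v2–v6 is IN HOUSE
import Summits.HodgeConjecture.HodgeConjecture.Theorems.F0P3cStCharTSLdsRedTwoOfReducible  -- ★ p852401 (F0P2-p06 g19) «LDS-RED-TWO ⟸ KEYS-RED-(3)»: `ldsRedTwo_of_keysRedThree` ((R2) inequivalence in house)
import Summits.HodgeConjecture.HodgeConjecture.Theorems.F0P3cStCharTSKeys3AnalyticHalf    -- ★ p853214 (F0P2-p06 g21, ROAD «KEYS3-ANALYTIC»; LH6-p04 g10, F0P2-p01 g26) `hKeysRed3_holds` : Keys' reducibility, case (3), at every non-split `v` — the outer `hKeysRed3` of v8–v16 is IN HOUSE (v17)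
import Summits.HodgeConjecture.HodgeConjecture.Theorems.F0P3cStCharTSEllMassH          -- ★ p852666 (F0P3a-p04 g29, ROAD «M5-H» (B5)) `ellipticWeylMass_H_eq_one` : Σ_{T∈SH} |Ω(T,H)|⁻¹ ∫_T D_H² = 1 (Kottwitz EP through ★ WIF-H; Mathlib + ★ only)
import Summits.HodgeConjecture.HodgeConjecture.Theorems.F0P3cStCharTSEllMassHJunction  -- ★ p852627 (F0P3b-p01 g21, (B6)+(M5-a)) `packetCharHNorm_of_ellipticWeylMass` : (M5) at the pins from the elliptic Weyl mass
import Summits.HodgeConjecture.HodgeConjecture.Theorems.F0P3cStCharTSEllInnerDatumDict     -- ★ p852667 (F0P2-p01 g24, ROAD «ELL-INNER» (E9) dock) `prop1252_of_concrete` : Prop. 12.5.2 on the concrete data ↦ `𝔇.Prop1252` by the pins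
import Summits.HodgeConjecture.HodgeConjecture.Theorems.F0P3cStCharTSEllInnerConcreteHead   -- ★ p852706 (F0P3a-p06 g23, ROAD «ELL-INNER» F-head) `prop1252_concrete` : Prop. 12.5.2 ON THE CONCRETE DATA from the rung-0 Cartan binders alone (★ (E0)–(E8), (E2b), (E4″) inside)
import Summits.HodgeConjecture.HodgeConjecture.Theorems.F0P3cStCharTSPcValueAtOne          -- ★ p852744 (F0P3a-p02 g26) «PC-VALUE-AT-ONE★» `exists_formalDegree_of_posOne` : (PL)+(d>0) ⟸ POS-ONE via (GERM-3)
import Summits.HodgeConjecture.HodgeConjecture.Theorems.F0P3cStCharTSGermThree           -- ★ (LH4-p03) S11 `germThree_local_of_germResidue`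
import Summits.HodgeConjecture.HodgeConjecture.Theorems.F0P3cStCharTSScPseudoCoeff        -- ★ p852902 (F0P3a-p02 g26) E2-5b «HC-SC» terminus: (P) `exists_isPseudoCoeff_of_isSupercuspidal` (supercuspidal pseudo-coefficients with `0 < f(1)` real)
import Summits.HodgeConjecture.HodgeConjecture.Theorems.F0P3cStCharTSEPGlueGNotWild          -- ★ p853093 (F0P3a-p09) `exists_epFunction_G_of_not_wild` (v unramified OR v ∤ 2)
import Summits.HodgeConjecture.HodgeConjecture.Theorems.F0P3cStCharTSEPPseudoCoeffStLetters  -- ★ p853007 (F0P3-p02 g25) (G5) `exists_isPseudoCoeff_stG_of_epFunction` (POS-ONE at `St_G(ψ)`)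
import Summits.HodgeConjecture.HodgeConjecture.Theorems.F0P3cStCharTSOpp23                   -- ★ p852725 (F0P2-p02 g23) OPP-23 `charOpposite_of_PS2`
import Summits.HodgeConjecture.HodgeConjecture.Theorems.F0P3cStCharTSPs2Assembly             -- ★ (LH6-p03) `ps2_of_kinds`
import Summits.HodgeConjecture.HodgeConjecture.Theorems.F0P3cStCharTSPs2Kind2Datum           -- ★ p851578 (LH6-p02) `ps2_kind2_of_fields`
import Summits.HodgeConjecture.HodgeConjecture.Theorems.F0P3cStCharTSLdsFields               -- ★ p851311 (LH6-p05) `lds_sockets_of_ldsFields`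
import Summits.HodgeConjecture.HodgeConjecture.Theorems.F0P3cStCharTSEllOpen                 -- ★ p851296 (F0P2-p06) `isOpen_setOf_isRegularElt_and_not_mem_hyperbolicSet`
import Summits.HodgeConjecture.HodgeConjecture.Theorems.F0P3cStCharTSParField                -- ★ p851306 (LH6-p03) `parField_sockets`
import HarnessLib

/-!
# F0 · P3c · line LH6 «StCharTS» — RUNG 0 v22 of the DATUM ROAD («K4′ NOT-WILD» — consequent 4 re-guarded by the not-wild disjunction; pairs with JUNCTION v17): conclusion = the 62 hypotheses of JUNCTION v15 ∧ the `eRegH` export (`∃ 𝔇 d T par μ_v, ‹the 62 hypotheses of ★ JUNCTION v8 p852644› ∧ eRegH`,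
# ED. 21's text with the package conjunct `UpSpec` ↦ `UpSpecLB` and the block consequent `UpTr` GONE — the locally-bounded transfer display is DERIVED inside junction v8 by the ROAD «UP-TR» terminal head) FROM THE NAMED BLOCK over the CONSTRUCTED §12.5 datum — the proof is v8's (★ p852452) token for token except the UP consequent

Cell `pub/hodgecm-mathlib`, crux H413 = `stmt-HodgeConjecture-24833` (lane `--supports …`), route HCCMUnconditional; seat LH6-p01 (g7) (rider pen, heir of g6; ONE token widened inside consequent 3 vs ★ v18 p853325).
THEOREMS ONLY (no definition ∕ instance ∕ notation ∕ named fact ∕ `sorry`); ★-only imports.  v1 (★ p851651), v2 (★ p851915), v3 (★ p851963) are untouched.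

WHAT.  `ellipticPackage_hyps_of_namedBlock₂₂` (v22 = v21 ★ p853850 with ONE consequent of `hBlock′` re-guarded — rider «K4′ NOT-WILD» (PAYDOWN-(J), LEAD T15-52 (B)∕T15-60 (A)): consequent 4 K4′ `hLdsOne ↦ hLdsOneR` = `∀ P ∈ 𝔇.ldsPackets, ∀ π ∈ P, ¬ (Algebra.IsUnramifiedIn (𝓞 L) v.asIdeal ∨ Valued.v (2 : v.adicCompletion ↥(maximalRealSubfield L)) = 1) → 𝔇.innerG (𝔇.char π) (𝔇.char π) = 1` (INSERT-ONLY; ★ 68-I-NW head `F0P3cStCharTSK4PrimeNotWild.innerG_char_self_eq_one_of_mem_ldsPackets_of_not_wild` p853846 rebuilds every non-wild instance inside ★ JUNCTION v17); consequents 6 = 6 (texts 1–3, 5, 6 byte-equal), Cartan binders + 54 pins 0 hunks, outer letters ≡ v21, conclusion = JUNCTION v17's 62 (letter #53 in LOCKSTEP) ∧ `eRegH`; proof ≡ v21 up to obtain∕constructor names; v21 = v20 ★ p853731 with THREE consequents of `hBlock′` re-guarded — riders «L²-UNR + NOT-WILD» (LEAD T15-58∕T15-59) + «(b)-REST NOT-WILD»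 (T16-03, folded by T16-12 (a)): consequent 3 Prop. 12.6.1 (b) `h61bNsEP ↦ h61bNsEPR` — `¬ (Algebra.IsUnramifiedIn (𝓞 L) v.asIdeal ∨ Valued.v (2 : v.adicCompletion ↥(maximalRealSubfield L)) = 1) →` inserted after `¬ π'.IsSupercuspidal →` (★ (X3′) head `F0P3cStCharTSP1261bRestNotWild.isEllipticPair_of_innerG_ne_zero_of_not_wild` p853805 rebuilds every non-wild instance inside ★ JUNCTION v16); consequent 1 [K] `hPCEnsNWR` — its place guard `¬ Algebra.IsUnramifiedIn (𝓞 L) v.asIdeal →` WIDENED to `¬ (Algebra.IsUnramifiedIn (𝓞 L) v.asIdeal ∨ Valued.v (2 : v.adicCompletion ↥(maximalRealSubfield L)) = 1) →` (★ row-69 head `F0P3cStCharTSK1NotWildPseudoCoeff.exists_isPseudoCoeff_of_not_wild` rebuilds every non-wild instance inside ★ JUNCTION v16); consequent 2 K2′ `hL2oneNsNW ↦ hL2oneNsNWR` — `¬ (Algebra.IsUnramifiedIn (𝓞 L) v.asIdeal ∨ Valued.v (2 : v.adicCompletion ↥(maximalRealSubfield L)) = 1) →` inserted after `¬ σ.IsSupercuspidal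 →` (★ 72-NW head `F0P3cStCharTSK2PrimeL2Tame.innerG_char_self_eq_one_of_isL2_of_not_wild` over ★ row-72 p853710 rebuilds every non-wild instance inside ★ JUNCTION v16; T15-59 (t3)); consequents 6 = 6 (texts 4–6 byte-equal), Cartan binders + 54 pins 0 hunks, outer letters ≡ v20, conclusion = JUNCTION v16's 62 (letters #50∕#51∕#52 in LOCKSTEP) ∧ `eRegH`; proof ≡ v20 up to obtain∕constructor names; v20 = v19 ★ p853489 with block consequent 1 [K] `hPCEnsNW ↦ hPCEnsNWR`: the place guard `¬ Algebra.IsUnramifiedIn (𝓞 L) v.asIdeal →` inserted after `¬ π.IsSupercuspidal →` (LEAD T15-39 (1)∕T15-44 «K1-UNR» PAYDOWN-UNR: at an UNRAMIFIED place every elliptic non-supercuspidal class gets its pseudo-coefficient IN HOUSE inside ★ JUNCTION v15 by the (R-SS) assembly head ★ `F0P3cStCharTSK1UnrPseudoCoeff.exists_isPseudoCoeff_of_unramified` p853690 — Schneider–Stuhler resolution on the lattice tree + Kottwitz's `f_EP`, E1 rows 21–61b, Mathlib + ★ only); consequents 6 = 6 (texts 2–6 byte-equal), Cartan binders + 54 pins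 0 hunks, outer letters ≡ v19 (6 + `T`), conclusion = JUNCTION v15's 62 (letter #50 in LOCKSTEP) ∧ `eRegH`; proof ≡ v19 up to the one obtain∕constructor name; v19 = v18 ★ p853325 with ONE TOKEN widened inside `hBlock′` consequent 3 = Prop. 12.6.1 (b)ns-EP (letter name `h61bNsEP` KEPT, LEAD T15-45 «2b′ NOT-WILD EP-PAIRS»): the guard's place conjunct `Algebra.IsUnramifiedIn (𝓞 L) v.asIdeal ↦ (Algebra.IsUnramifiedIn (𝓞 L) v.asIdeal ∨ Valued.v (2 : v.adicCompletion ↥(maximalRealSubfield L)) = 1)` — the pairs INSIDE the EP family {`St_G(ψ)`, `ψ∘det_G`} are REBUILT inside ★ JUNCTION v14 at EVERY NON-WILD place by ★ P4 `F0P3cStCharTSEPPairsNotWild.isEllipticPair_of_epFamily_of_not_wild` (F0P3a-p06 (g25) p853443; place-free layer ★ P1 p853317 · P2a p853364 · P2b p853385 · P3 p853413 over ★ NOT-WILD (G3)-EXPLICIT p853198); consequents 6 = 6 (texts 1∕2∕4∕5∕6 byte-equal), Cartan binders + 54 pins 0 hunks, outer letters ≡ v18, conclusion = JUNCTION v14's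 62 (letter #52 widened in LOCKSTEP) ∧ `eRegH`; proof ≡ v18; v18 = v17 ★ R17 (LH6-p05 (g6)) with ONE consequent of `hBlock′` RE-GUARDED — «EP-PAIRS», RIDER 2b (LEAD F0P3a-plan (g16) T15-24 (1)∕(2), T15-30): consequent 3 = Prop. 12.6.1 (b) for elliptic non-supercuspidal classes `h61bNs` ↦ `h61bNsEP`, i.e. after `¬ π'.IsSupercuspidal →` the guard `¬ (Algebra.IsUnramifiedIn (𝓞 L) v.asIdeal ∧ (∃ ψ : ↥(Subgroup.center (Gqs L v)) →* ℂˣ, Continuous ψ ∧ (π = 𝔇.stG ψ ∨ π = 𝔇.detG ψ)) ∧ (∃ ψ' : ↥(Subgroup.center (Gqs L v)) →* ℂˣ, Continuous ψ' ∧ (π' = 𝔇.stG ψ' ∨ π' = 𝔇.detG ψ'))) →` is inserted (place token = `IsUnramifiedIn` ALONE): the pairs INSIDE the EP family {`St_G(ψ)`, `ψ∘det_G`} at an unramified `v` are REBUILT inside ★ JUNCTION v13 by ★ H `F0P3cStCharTSEPPairsDatum.isEllipticPair_of_epFamily` (F0P3a-p06 (g25); ★ G trace table `isEllipticPairEP_datum`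 p853265 over ★ F EP-TRACES p853248, ★ (G3)-EXPLICIT p853069, ★ PCT-OUT); consequents 6 = 6 (texts 1∕2∕4∕5∕6 byte-equal), Cartan binders + 54 pins 0 hunks, outer letters ≡ v17 (6 + `T`), conclusion = JUNCTION v13's 62 (letter #52 re-guarded in LOCKSTEP) ∧ `eRegH`; proof ≡ v17 up to the one obtain∕constructor name; v17 = v16 ★ p853130 with the OUTER LETTER `hKeysRed3` — Keys' reducibility, case (3) ALONE («`i_G(χ₁,χ₂)` with `χ₁|_{F×} = 1`, `χ₁ ≠ 1` is reducible» [Keys1984 §7 Thm. (1); R90 §12.2 (3) p. 174]) — GONE: PAID IN HOUSE by ROAD «KEYS3-ANALYTIC» ★ p853214 `F0P3cStCharTSKeys3AnalyticHalf.hKeysRed3_holds L v hns` (F0P2-p06 (g21) closing file over ★ B1–B6∕D1∕D2 of F0P2-p06, LH6-p04 (g10), F0P2-p01 (g26); second eigenfunctional on the open-cell torus character + ★ `keysRedThree_of_secondEigenfunctional`; Mathlib + ★ only, NO printed input): the derived letter `hLdsTwo` now reads `ldsTwo_of_ldsReducibleTwo L v hns (ldsRedTwo_of_keysRedThree L v hns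 (hKeysRed3_holds L v hns))`; outer Prop letters 7 → 6 (`hHC hHCB hT3 hGerm hKeysRed hBlock′` + the torus binder `T`); `hBlock′` (Cartan binders, 54 pins, SIX consequents), antecedent discharges, in-house derivations and the ∃-conclusion (62 ∧ `eRegH`) IDENTICAL to v16 — so it still pairs with ★ JUNCTION v12 p853129; v16 = v15 ★ p853072 with ONE token moved: the place condition of the EP guard `Algebra.IsUnramifiedIn (𝓞 L) v.asIdeal` ↦ `Algebra.IsUnramifiedIn (𝓞 L) v.asIdeal ∨ Valued.v (2 : v.adicCompletion ↥(maximalRealSubfield L)) = 1` («not wild»), discharged by ★ `exists_epFunction_G_of_not_wild` p853093 (F0P3a-p09) — the EP-family instances of K1∕K2′∕POS-ONE are theorems at EVERY NON-WILD place; v15 = v14 ★ p852956 with the «EP-SPLIT» (RIDER 2a; (G3) `exists_epFunction_G` p853021 at unramified v, (G4) p852975∕p853003, (G5) p852994∕p853007): the block consequents K1, K2′ and POS-ONE additionally exclude the `St_G(ψ)`∕`ψ∘det` instances at unramified `v` by the guard `¬ (Algebra.IsUnramifiedIn (𝓞 L) v.asIdeal ∧ ∃ ψ, Continuous ψ ∧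 …)` — those instances are REBUILT inside ★ JUNCTION v11 (K1, K2′) and here at rung 0 (POS-ONE: ★ (G5) `exists_isPseudoCoeff_stG_of_epFunction` over ★ (G3) `hEP` and ★ OPP-23 at the pair `(detG ψ, stG ψ)`, the latter re-derived at rung 0 from the pins exactly as the junction does); the ST-PIN EXTRA `eSt` becomes a JUNCTION LETTER (conjunct 62 of the conclusion; still discharged here); at a RAMIFIED place nothing moves ((G3)-RAM∕WILD open); outer list UNCHANGED (fence (α)); v14 = v13 ★ p852762 with the «SC-SPLIT» (ROAD «HC-SC» E2 ★ end to end: E2-1 p852781∕p852790 · E2-2 p852824∕p852832 · E2-3a p852769∕p852804 · E2-3b p852880∕p852891 · E2-4 core + p852863 · E2-5a p852860 · E2-5b p852902; compact induction + Schur orthogonality, Mathlib + ★ only): the block consequents [K] `PseudoCoeffExists`, K2′ «L² norm one», Prop. 12.6.1 (b) and POS-ONE are RE-LETTERED to their NON-SUPERCUSPIDAL instances (`¬ π.IsSupercuspidal →` inserted) — the supercuspidal instances are REBUILT inside ★ JUNCTION v10 by ★ (P)(N1)(N0) of `F0P3cStCharTSScPseudoCoeff` and, for POS-ONE, here at rung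 0 by ★ (P) right after the block; outer list UNCHANGED (fence (α)); conclusion = J10's 61 (texts 49∕51∕52 re-lettered) ∧ `eRegH`; v13 = v12 ★ p852741 with FOUR LETTER MOVES, each backed by a ★ kernel dock: (i) block consequents `Ch12Sec6.Prop1261a 𝔇` ↦ K2′ `hL2one : ∀ σ, 𝔇.IsL2 σ → 𝔇.innerG (𝔇.char σ) (𝔇.char σ) = 1` and `Ch12Sec6.Prop1261c 𝔇` ↦ K4′ `hLdsOne : ∀ P ∈ 𝔇.ldsPackets, ∀ π ∈ P, 𝔇.innerG (𝔇.char π) (𝔇.char π) = 1` (Prop. 12.6.1 (a)(c) REBUILT inside ★ JUNCTION v9 by ★ p852737 `prop1261a_of_norms` ∕ ★ p852727 `prop1261c_of_prop1261a` over ★ p852725 OPP-23 — LEAD T14-51∕T14-55, F0P2-p02 (g23) CERT v2 026d1a8e); (ii) block consequent `Ch12Sec6.EllipticOfNotPrincipalSeries 𝔇` GONE — DERIVED inside JUNCTION v9 by ★ EONPS-OUT (F0P3a-p05 (g25)) from the rebuilt Prop. 12.6.1 (c), ★ RED-JH and the definitional EXTRA `eIrr`, which therefore becomes a JUNCTION LETTER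 (conjunct 61 of the conclusion; still discharged here by `hirrE'`); (iii) the ∃-tail `∃ d, (PL) ∧ (d > 0)` ↦ «POS-ONE» `∀ π, 𝔇.IsL2 π → ∃ f, 𝔇.IsPseudoCoeff π f ∧ 0 < (f 1).re ∧ (f 1).im = 0` with `⟨d, hPL, hdpos⟩` RE-DERIVED at rung 0 by ★ p852744 `exists_formalDegree_of_posOne` through (GERM-3) at the type-(3) torus `T` (F0P3a-p02 (g26), CERT-O3-PosOne-dock 6b8def96); block consequents at v13: [K] `PseudoCoeffExists` · K2′ · Prop. 12.6.1 (b) · K4′ · (R0) · POS-ONE; outer list UNCHANGED (fence (α)); v12 = v11 (p852707) with the block consequent `h1252 : 𝔇.Prop1252` («⟨α₁^G, α₂^G⟩_{G,e} = 2⟨α₁, α₂⟩_{H,e}» [Rogawski1990 Prop. 12.5.2 pp. 184–185]) GONE from `hBlock′` too — PAID IN HOUSE by ROAD «ELL-INNER» (LEAD T14-40∕T14-44; map owner LH6-p03 (g7); bricks (E0) p852642 (E0)′ (E0a) (E0b) p852649 (E2) p852647 (E2b)-A∕B∕C (E3) p852615 (E4)(E4′)(E4″) p852562∕p852638∕p852686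 (E6) p852672 (E7) p852616 (E8) p852636, F-core p852692, F-head p852706, dock p852667 — Mathlib + ★ only, NO printed input): `have h1252 := F0P3cStCharTSEllInnerDatumDict.prop1252_of_concrete L v μ 𝔇 Sell μTf SH μTHf eDG eDH hStH hUp eCartanG eMuT eCartanH eMuTH eEllH (F0P3cStCharTSEllInnerConcreteHead.prop1252_concrete L v hns μ hμu Sell μTf SH μTHf hcartO hcovGO hncGO hHaarGO hcoreGO hKHO hcovHO hncHO hHaarHO hprobHO)` — every argument a rung-0 binder∕pin BY NAME; block consequents 7 → 6 (PCE · 1261a∕b∕c · EllNotPS · R0 + ∃ d); conclusion ≡ v11 ≡ v10 (62 conjuncts); outer list UNCHANGED (fence (α)); v11 = v10 ★ p852661 with the block consequent `hM5 : 𝔇.PacketCharHNorm` («⟨χ_ρ, χ_ρ⟩_{H,e} = Card ρ» at `ρ = {St_H(ξ)}` [Rogawski1990 Cor. 12.5.4 proof p. 186]) GONE from `hBlock′` — PAID IN HOUSE by ROAD «M5-H» (LEAD T14-41; holder F0P3a-p04 (g29); (B1)–(B6) ★ p852574 p852595 p852628 p852624 p852641 p852627 p852666, Mathlib + ★ only,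 NO printed input): `have hM5 := F0P3cStCharTSEllMassHJunction.packetCharHNorm_of_ellipticWeylMass … SH μTHf hKHO hHaarHO 𝔇 hC02 ‹dh := the eDH closed form› eDH hM1lc hM1H eCartanH eMuTH eSq (F0P3cStCharTSEllMassH.ellipticWeylMass_H_eq_one … SH μTHf hKHO hcovHO hncHO hHaarHO hprobHO _ (fun _ => rfl))` — the holder's rider term verbatim, every argument a rung-0 binder∕pin BY NAME; block consequents 8 → 7 (1252 · PCE · 1261a∕b∕c · EllNotPS · R0 + ∃ d); conclusion ≡ v10 (62 conjuncts, `hM5` now supplied by the `have`); outer list UNCHANGED (no new outer binder, fence (α)); v10 = v9 ★ p852561 with ONE MORE CONJUNCT APPENDED AT THE END of the ∃-conclusion: the block EXTRA `eRegH : ∀ a, a ∈ 𝔇.regH ↔ IsLocalGRegular L v a` EXPORTED (definitional at rung 0 — `𝔇.regH` IS the `G`-regular set, `hregHE`; discharged by the same `a_eRegH`), so that the LEAF can feed the `regH`-form local-boundedness antecedent of the ★ `_LB` consumer heads from the package's `IsLocalGRegular`-form pin `hHBHP` — LEAD T14-45 (A) ∕ ED. 26 pen (A′); `hBlock′`, outer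 list, antecedents, proof IDENTICAL to v9; NOT an outer binder; v9 = v8 with the package conjunct `𝔇.UpSpec` ↦ `𝔇.UpSpecLB` in the conclusion (junction v8) and the block consequent `hUpTr` GONE — PAID in house by ROAD «UP-TR» inside junction v8 (block consequents 9 → 8; NO new outer binder, LEAD T14-26 (α)); v8 = v7 with the outer `hLdsRedTwo` RE-LETTERED to `hKeysRed3` = Keys' reducibility, case (3) ALONE («`i_G(χ₁,χ₂)` with `χ₁|_{F×} = 1`, `χ₁ ≠ 1` is reducible» [Keys1984 §7 Thm. (1); R90 §12.2 p. 173]) — the inequivalence of the two constituents (R2) is now ★ in house (`F0P3cStCharTSLdsRedTwoOfReducible`, F0P2-p06 (g19)); v7 = v6 with the outer (HC-D) `hDGliO` GONE — ★ ROAD HC-D `F0P3cStCharTSWeylDiscrLocInt.locallyIntegrable_weylDiscr_inv` [HarishChandra1970 VII §1 Thm. 15 for `U(3)`, IN HOUSE: ultrametric Newton charts + Cayley + transport, F0P2-p01 (g23) et al.]; outer Prop binders 8 → 7; v6 = v5 concluding the junction-v7 form: block consequent WIF GONE — ★ `weylIntegrationFormula_of_datumPins` inside ★ JUNCTION v7 —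 the new junction pins `hcovA hncA hcptA hinvT hcoreT` DISCHARGED here from the Cartan binders of `hBlock'` via ★ INSTANTIATE-CARTAN ED. 2, with NO new outer input (JAC-ELL C8's terminus ★ p852343 pays the compact-Cartan tube-Jacobian socket inside ★ JUNCTION v7) — the WEYL INTEGRATION FORMULA has LEFT the organ; v5 = v4 with the CARTAN DATA FOLDED: `Sell μTf SH μTHf` are no longer outer objects — ★ INSTANTIATE-CARTAN `exists_cartanInputs` builds them — and the named block now quantifies over them: `hBlock' : ∀ Sell μTf SH μTHf, ‹12 Cartan binders› → ∀ 𝔇 par, PINS → CONS`; outer objects 5 → 1 (the type-(3) torus `T`), outer Prop binders 20 → 8; and `hLdsTwo` RE-LETTERED to `hLdsRedTwo` = «the unitary `i_G(χ₁,χ₂)` with `χ₁|_{F×} = 1`, `χ₁ ≠ 1` has two DISTINCT constituents» [Keys1984 §7 Thm. (1); R90 §12.2 (3)] via ★ LDS-TWO-OF-TWO, an equivalence): under the organ's binder prefix (verbatim, up to `μZ`), GIVEN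
under the organ's binder prefix (verbatim, up to `μZ`), GIVEN the outer letters `hHC` (§1.6), `hHCB` (HC-B), `T` with `hT3`, `hGerm` [§8.1], `hKeysRed` [Keys1984 §7, the list (⇒)] and the NAMED BLOCK `hBlock′` (∀ Cartan data `Sell μTf SH μTHf` with their 12 print properties, ∀ `𝔇 par` with the 54 pins → the six re-lettered consequents K1 · K2′ · 12.6.1 (b) · K4′ · (R0) · POS-ONE),
THEN the organ in its junction form `∃ 𝔇 d T par μ_v, ‹the junction's hypotheses in order› ∧ eRegH`.  PROOF = v1's (★ ∃-pins S1 CHAR-FIELD, DG-FIELD(-TWO), ST-PIN, KEYS-PAIRS, H-FIELDS-HCB,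
PAR-FIELD-W → ★ WITNESS → the antecedents → the block) with LH-ref1's four leak fixes of v3 (outer data DETERMINED; `irredPS`, `pi2`∕`piN`, (M1H) pinned; residual freedom = `par` mod W, `char` off `regG`,
representative choice in `Sell`∕`SH`) — see ★ R3 p851963 ∕ ★ R8 p852452's docstrings for the full census.
HONESTY: as v1 — every antecedent is an `Eq`∕`Iff`∕★-pin on a read field, the proof EXHIBITS a datum meeting all of them (non-vacuity certificate: ★ WITNESS `exists_datum_with_fields`
+ this proof), so each consequent is the printed theorem about THOSE objects.  HONEST LABEL: HC_CM is proved only modulo the 7 printed citations (2 remaining named inputs: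
hLiu418 = `stmt-HodgeConjecture-24832`, h413 = `stmt-HodgeConjecture-24833`) until rung 0 closes; this file closes no organ — it re-states (S-𝔇)'s remaining debt (count-neutral).

## References
* [Rogawski1990] J. D. Rogawski, *Automorphic Representations of Unitary Groups in Three Variables*, Ann. of Math. Stud. 123 (1990): §1.6 p. 5; §3.6 pp. 28–31; §8.1 pp. 112–116;
  §12.2 pp. 172–174; §12.5 pp. 182–187; §12.6 pp. 187–189; Lemma 12.7.2 (proof) pp. 191–194.
* [Keys1984] D. Keys, *Principal series representations of special unitary groups over local fields*, Compositio Math. 51 (1984), §7.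
* [HarishChandra1970] Harish-Chandra (notes by G. van Dijk), *Harmonic Analysis on Reductive p-adic Groups*, LNM 162 (1970): Part VII §1, Theorem 15.
-/

set_option autoImplicit false
-- the mandated namespace has the single-problem summit's repeated segment (`HodgeConjecture.HodgeConjecture`)
set_option linter.dupNamespace false

noncomputable section

open NumberField IsDedekindDomain MeasureTheory Filter Topology
open scoped Matrix MatrixGroups NNReal ENNReal
open Literature.MeasureTheory.Group
open Literature.NumberTheory.Rogawski1990 Literature.NumberTheory.Automorphic Literature.NumberTheory.Automorphic.UnitaryGroup
open Literature.NumberTheory.Automorphic.UnitaryGroup.CotangentForms Literature.NumberTheory.GaloisRepresentations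
open Literature.NumberTheory.Automorphic.Arthur2013.Leaves.TECR
open Summit.HodgeConjecture.HodgeConjecture.Cruxes.H413.F0P3cStCharTSTorusDefs

namespace Summit.HodgeConjecture.HodgeConjecture.Cruxes.H413.F0P3cStCharTSRung0TwentyTwo

open scoped Classical in
set_option maxHeartbeats 8000000 in
set_option synthInstance.maxHeartbeats 400000 in
-- statement = the (S-𝔇) organ in its JUNCTION-v5 form behind the named block; proof = the ★ ∃-pins, the ★ witness, 50 pin transports
/-- **RUNG 0 v10 — (S-𝔇) (JUNCTION-v8 form, `UpSpecLB`, + the `eRegH` export) from the NAMED BLOCK; WIF, (HC-D), (R2), (UP-TR), (M5), (1252), (EONPS), (SC instances of K1∕K2′∕K3∕POS-ONE) in house; outer Keys letter = the list (⇒); case (3) (⇐) IN HOUSE (★ KEYS3-ANALYTIC p853214, v17); 12.6.1 (b) EP-pairs at every non-wild `v` IN HOUSE (★ H v18, ★ P4 v19).**  See the module docstring for the census of hypotheses and the honesty argument.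
[cite: Rogawski1990, §12.5 pp. 182–187; §12.6 pp. 187–189; Lemma 12.7.2 (proof) pp. 191–194; §1.6 p. 5; §3.6 pp. 28–31; §12.2 pp. 172–174; §8.1 pp. 112–116] [cite: Keys1984, §7] [cite: HarishChandra1970, Part VII §1 Thm. 15] -/

theorem ellipticPackage_hyps_of_namedBlock₂₂ :
  ∀ (L : Type) [Field L] [NumberField L] [IsCMField L] (μ : HeckeCharacter L) (ξ : OneDimAutRepH L) (v : HeightOneSpectrum (𝓞 ↥(maximalRealSubfield L))),
    (∀ w : PlacesOver L v, IsCMField.complexConj L • w.1 = w.1) → μ.IsUnitary →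
    (∀ x : Literature.NumberTheory.GaloisRepresentations.ideleGroup ↥(maximalRealSubfield L),
      μ (AdeleRing.ideleBaseChange (↥(maximalRealSubfield L)) L x) = quadraticHeckeCharCM L x) →
    ∀ [MeasurableSpace (((UnitaryGroup.cmDatum L 2 (Matrix.of fun i j : Fin 2 => if i.val + j.val + 1 = 2 then (1 : L) else 0)).Local v × (UnitaryGroup.cmDatum L 1 (Matrix.of fun i j : Fin 1 => if i.val + j.val + 1 = 1 then (1 : L) else 0)).Local v))] [BorelSpace (((UnitaryGroup.cmDatum L 2 (Matrix.of fun i j : Fin 2 => if i.val + j.val + 1 = 2 then (1 : L) else 0)).Local v × (UnitaryGroup.cmDatum L 1 (Matrix.of fun i j : Fin 1 => if i.val + j.val + 1 = 1 then (1 : L) else 0)).Local v))] [MeasurableSpace (Gqs L v)] [BorelSpace (Gqs L v)]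
      (νHv : Measure (((UnitaryGroup.cmDatum L 2 (Matrix.of fun i j : Fin 2 => if i.val + j.val + 1 = 2 then (1 : L) else 0)).Local v × (UnitaryGroup.cmDatum L 1 (Matrix.of fun i j : Fin 1 => if i.val + j.val + 1 = 1 then (1 : L) else 0)).Local v))) (νQv : Measure (Gqs L v))
      [νHv.IsHaarMeasure] [νHv.IsMulRightInvariant] [νQv.IsHaarMeasure] [νQv.IsMulRightInvariant],
    letI : ∀ a : ((UnitaryGroup.cmDatum L 2 (Matrix.of fun i j : Fin 2 => if i.val + j.val + 1 = 2 then (1 : L) else 0)).Local v × (UnitaryGroup.cmDatum L 1 (Matrix.of fun i j : Fin 1 => if i.val + j.val + 1 = 1 then (1 : L) else 0)).Local v), MeasurableSpace (((UnitaryGroup.cmDatum L 2 (Matrix.of fun i j : Fin 2 => if i.val + j.val + 1 = 2 then (1 : L) else 0)).Local v × (UnitaryGroup.cmDatum L 1 (Matrix.of fun i j : Fin 1 => if i.val + j.val + 1 = 1 then (1 : L) else 0)).Local v) ⧸ Subgroup.centralizer ({a} : Set (((UnitaryGroup.cmDatum L 2 (Matrix.of fun i j : Fin 2 => if i.val + j.val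 + 1 = 2 then (1 : L) else 0)).Local v × (UnitaryGroup.cmDatum L 1 (Matrix.of fun i j : Fin 1 => if i.val + j.val + 1 = 1 then (1 : L) else 0)).Local v)))) := fun _ => borel _
    haveI : ∀ a : ((UnitaryGroup.cmDatum L 2 (Matrix.of fun i j : Fin 2 => if i.val + j.val + 1 = 2 then (1 : L) else 0)).Local v × (UnitaryGroup.cmDatum L 1 (Matrix.of fun i j : Fin 1 => if i.val + j.val + 1 = 1 then (1 : L) else 0)).Local v), BorelSpace (((UnitaryGroup.cmDatum L 2 (Matrix.of fun i j : Fin 2 => if i.val + j.val + 1 = 2 then (1 : L) else 0)).Local v × (UnitaryGroup.cmDatum L 1 (Matrix.of fun i j : Fin 1 => if i.val + j.val + 1 = 1 then (1 : L) else 0)).Local v) ⧸ Subgroup.centralizer ({a} : Set (((UnitaryGroup.cmDatum L 2 (Matrix.of fun i j : Fin 2 => if i.val + j.val + 1 = 2 then (1 : L) else 0)).Local v × (UnitaryGroup.cmDatum L 1 (Matrix.of fun i j : Fin 1 => if i.val + j.val + 1 = 1 then (1 : L) else 0)).Local v)))) := fun _ => ⟨rfl⟩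
    letI : ∀ γ : Gqs L v, MeasurableSpace (Gqs L v ⧸ Subgroup.centralizer ({γ} : Set (Gqs L v))) := fun _ => borel _
    haveI : ∀ γ : Gqs L v, BorelSpace (Gqs L v ⧸ Subgroup.centralizer ({γ} : Set (Gqs L v))) := fun _ => ⟨rfl⟩
    ∀ (mHv : OrbitalMeasureFamily (((UnitaryGroup.cmDatum L 2 (Matrix.of fun i j : Fin 2 => if i.val + j.val + 1 = 2 then (1 : L) else 0)).Local v × (UnitaryGroup.cmDatum L 1 (Matrix.of fun i j : Fin 1 => if i.val + j.val + 1 = 1 then (1 : L) else 0)).Local v))) (mQv : OrbitalMeasureFamily (Gqs L v)),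
      mHv.IsCanonical (IsLocalGRegular L v) νHv →
      mQv.IsCanonical (fun γ => IsRegularElt (γ.val : GL (Fin 3) (UnitaryGroup.LocalRing L v))) νQv →
      IsLocalDeltaTransferExists L (qsForm L) v ((finExplicitCollection L (qsForm L) μ (finExplicitDelta_conj_left_all L (qsForm L) μ) (finExplicitDelta_conj_right_all L (qsForm L) μ)) v) mHv mQv IsLocSmooth IsLocSmooth →
      ∀ (π₁ πSt : IrrClass (((UnitaryGroup.cmDatum L 2 (Matrix.of fun i j : Fin 2 => if i.val + j.val + 1 = 2 then (1 : L) else 0)).Local v × (UnitaryGroup.cmDatum L 1 (Matrix.of fun i j : Fin 1 => if i.val + j.val + 1 = 1 then (1 : L) else 0)).Local v))),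
        HLengthTwoLabels L v
          (torusCharPair (conjLocal L (IsCMField.complexConj L) v) (cmLocalForm L 2 v) (cmLocalForm_eq_over L 2 v) 0
            ((torusLocalComponent L (IsCMField.complexConj L) v ξ.η).comp
                (quotConj (conjLocal L (IsCMField.complexConj L) v) (conjLocal_conjLocal_cm L v)) *
              halfModulusChar (UnitaryGroup.LocalRing L v))
            (torusLocalComponent L (IsCMField.complexConj L) v ξ.ψ))
          ((torusLocalComponent L (IsCMField.complexConj L) v ξ.ψ).comp (localDet (IsCMField.complexConj L) v (isUnit_antidiagOne_det L 1))) π₁ πSt →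
        (∀ fH : ((UnitaryGroup.cmDatum L 2 (Matrix.of fun i j : Fin 2 => if i.val + j.val + 1 = 2 then (1 : L) else 0)).Local v × (UnitaryGroup.cmDatum L 1 (Matrix.of fun i j : Fin 1 => if i.val + j.val + 1 = 1 then (1 : L) else 0)).Local v) → ℂ, IsLocSmooth fH → π₁.smoothTrace νHv fH = charDist (ξ.xiLocalChar v) νHv fH) →
      ∀ [MeasurableSpace (Gqs L v ⧸ Subgroup.center (Gqs L v))] [BorelSpace (Gqs L v ⧸ Subgroup.center (Gqs L v))]
        (μZ : Measure (Gqs L v ⧸ Subgroup.center (Gqs L v))) [μZ.IsHaarMeasure],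

      Ch1.characterLocallyIntegrable →  -- hHC
      normalizedCharacter_locallyBounded →  -- hHCB
      ∀ (T : Subgroup (Gqs L v)),
      (∀ γ ∈ T, IsRegularElt (γ.val : GL (Fin 3) (UnitaryGroup.LocalRing L v)) → ∀ c : UnitaryGroup.LocalRing L v, ¬ ((γ.val.val : Matrix (Fin 3) (Fin 3) (UnitaryGroup.LocalRing L v)).charpoly).IsRoot c) →  -- hT3
      ShalikaGermResidueAtTorus L (qsForm L) v mQv T →  -- hGerm
      (∀ (χ₁ : (UnitaryGroup.LocalRing L v)ˣ →* ℂˣ) (χ₂ : ↥(normOneUnits (conjLocal L (IsCMField.complexConj L) v)) →* ℂˣ), Continuous (fun x => ((χ₁ x : ℂˣ) : ℂ)) → Continuous (fun x => ((χ₂ x : ℂˣ) : ℂ)) → (∃ N : Subrepresentation (UnitaryGroup.cmPrincipalSeries L 3 v (UnitaryGroup.cmTorusCharPair L v χ₁ χ₂)), N ≠ ⊥ ∧ N ≠ ⊤) → (χ₁ = halfModulusChar (UnitaryGroup.LocalRing L v) * halfModulusChar (UnitaryGroup.LocalRing L v) ∨ χ₁ = (halfModulusChar (UnitaryGroup.LocalRing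 L v) * halfModulusChar (UnitaryGroup.LocalRing L v))⁻¹) ∨ (∃ η : (UnitaryGroup.LocalRing L v)ˣ →* ℂˣ, IsQuadraticCharExtension (conjLocal L (IsCMField.complexConj L) v) η ∧ Continuous (fun x => ((η x : ℂˣ) : ℂ)) ∧ (χ₁ = η * halfModulusChar (UnitaryGroup.LocalRing L v) ∨ χ₁ = η * (halfModulusChar (UnitaryGroup.LocalRing L v))⁻¹)) ∨ (χ₁ ≠ 1 ∧ ∀ a : (UnitaryGroup.LocalRing L v)ˣ, (conjLocal L (IsCMField.complexConj L) v) (a : UnitaryGroup.LocalRing L v) = a → χ₁ a = 1)) →  -- hKeysRed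
      (∀ (Sell : Finset (Subgroup (Gqs L v))) (μTf : (T' : Subgroup (Gqs L v)) → Measure ↥T') (SH : Finset (Subgroup ((UnitaryGroup.cmDatum L 2 (Matrix.of fun i j : Fin 2 => if i.val + j.val + 1 = 2 then (1 : L) else 0)).Local v × (UnitaryGroup.cmDatum L 1 (Matrix.of fun i j : Fin 1 => if i.val + j.val + 1 = 1 then (1 : L) else 0)).Local v))) (μTHf : (T' : Subgroup ((UnitaryGroup.cmDatum L 2 (Matrix.of fun i j : Fin 2 => if i.val + j.val + 1 = 2 then (1 : L) else 0)).Local v × (UnitaryGroup.cmDatum L 1 (Matrix.of fun i j : Fin 1 => if i.val + j.val + 1 = 1 then (1 : L) else 0)).Local v)) → Measure ↥T'),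
        (∀ T ∈ Sell, IsCompact (T : Set (Gqs L v)) ∧ ∃ γ₀ : Gqs L v, IsRegularElt (γ₀.val : GL (Fin 3) (UnitaryGroup.LocalRing L v)) ∧ T = Subgroup.centralizer ({γ₀} : Set (Gqs L v))) →  -- hcartO
        (∀ γ : (Gqs L v), IsRegularElt (γ.val : GL (Fin 3) (UnitaryGroup.LocalRing L v)) → ∃ T' ∈ insert (cmBorelTriple L 3 v).M Sell, ∃ x : (Gqs L v), ∀ g : (Gqs L v), g ∈ Subgroup.centralizer ({γ} : Set (Gqs L v)) ↔ x⁻¹ * g * x ∈ T') →  -- hcovGO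
        (∀ T' ∈ insert (cmBorelTriple L 3 v).M Sell, ∀ T'' ∈ insert (cmBorelTriple L 3 v).M Sell, T' ≠ T'' → ∀ y : (Gqs L v), ¬ ∀ h : (Gqs L v), h ∈ T'' ↔ y⁻¹ * h * y ∈ T') →  -- hncGO
        (∀ T ∈ Sell, (μTf T).IsHaarMeasure) →  -- hHaarGO
        (∀ T' ∈ Sell, μTf T' (compactCore ↥T') = 1) →  -- hcoreGO
        (μTf (cmBorelTriple L 3 v).M).IsHaarMeasure →  -- hHaarMO
        (μTf (cmBorelTriple L 3 v).M (compactCore ↥(cmBorelTriple L 3 v).M) = 1) →  -- hcoreMO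
        (∀ T' ∈ SH, IsCompact (T' : Set ((UnitaryGroup.cmDatum L 2 (Matrix.of fun i j : Fin 2 => if i.val + j.val + 1 = 2 then (1 : L) else 0)).Local v × (UnitaryGroup.cmDatum L 1 (Matrix.of fun i j : Fin 1 => if i.val + j.val + 1 = 1 then (1 : L) else 0)).Local v)) ∧ ∃ γ₀ : ((UnitaryGroup.cmDatum L 2 (Matrix.of fun i j : Fin 2 => if i.val + j.val + 1 = 2 then (1 : L) else 0)).Local v × (UnitaryGroup.cmDatum L 1 (Matrix.of fun i j : Fin 1 => if i.val + j.val + 1 = 1 then (1 : L) else 0)).Local v), IsLocalGRegular L v γ₀ ∧ T' = Subgroup.centralizer ({γ₀} : Set ((UnitaryGroup.cmDatum L 2 (Matrix.of fun i j : Fin 2 => if i.val + j.val + 1 = 2 then (1 : L) else 0)).Local v × (UnitaryGroup.cmDatum L 1 (Matrix.of fun i j : Fin 1 => if i.val + j.val + 1 = 1 then (1 : L) else 0)).Local v))) →  -- hKHO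
        (∀ γ₀ : ((UnitaryGroup.cmDatum L 2 (Matrix.of fun i j : Fin 2 => if i.val + j.val + 1 = 2 then (1 : L) else 0)).Local v × (UnitaryGroup.cmDatum L 1 (Matrix.of fun i j : Fin 1 => if i.val + j.val + 1 = 1 then (1 : L) else 0)).Local v), IsLocalGRegular L v γ₀ → IsCompact ((Subgroup.centralizer ({γ₀} : Set ((UnitaryGroup.cmDatum L 2 (Matrix.of fun i j : Fin 2 => if i.val + j.val + 1 = 2 then (1 : L) else 0)).Local v × (UnitaryGroup.cmDatum L 1 (Matrix.of fun i j : Fin 1 => if i.val + j.val + 1 = 1 then (1 : L) else 0)).Local v)) : Subgroup ((UnitaryGroup.cmDatum L 2 (Matrix.of fun i j : Fin 2 => if i.val + j.val + 1 = 2 then (1 : L) else 0)).Local v × (UnitaryGroup.cmDatum L 1 (Matrix.of fun i j : Fin 1 => if i.val + j.val + 1 = 1 then (1 : L) else 0)).Local v)) : Set ((UnitaryGroup.cmDatum L 2 (Matrix.of fun i j : Fin 2 => if i.val + j.val + 1 = 2 then (1 : L) else 0)).Local v × (UnitaryGroup.cmDatum L 1 (Matrix.of fun i j : Fin 1 =>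 if i.val + j.val + 1 = 1 then (1 : L) else 0)).Local v)) → ∃ T' ∈ SH, ∃ x : ((UnitaryGroup.cmDatum L 2 (Matrix.of fun i j : Fin 2 => if i.val + j.val + 1 = 2 then (1 : L) else 0)).Local v × (UnitaryGroup.cmDatum L 1 (Matrix.of fun i j : Fin 1 => if i.val + j.val + 1 = 1 then (1 : L) else 0)).Local v), Subgroup.centralizer ({x * γ₀ * x⁻¹} : Set ((UnitaryGroup.cmDatum L 2 (Matrix.of fun i j : Fin 2 => if i.val + j.val + 1 = 2 then (1 : L) else 0)).Local v × (UnitaryGroup.cmDatum L 1 (Matrix.of fun i j : Fin 1 => if i.val + j.val + 1 = 1 then (1 : L) else 0)).Local v)) = T') →  -- hcovHO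
        (∀ T' ∈ SH, ∀ T'' ∈ SH, (∃ x : ((UnitaryGroup.cmDatum L 2 (Matrix.of fun i j : Fin 2 => if i.val + j.val + 1 = 2 then (1 : L) else 0)).Local v × (UnitaryGroup.cmDatum L 1 (Matrix.of fun i j : Fin 1 => if i.val + j.val + 1 = 1 then (1 : L) else 0)).Local v), T'.map (MulAut.conj x).toMonoidHom = T'') → T' = T'') →  -- hncHO
        (∀ T' ∈ SH, (μTHf T').IsHaarMeasure) →  -- hHaarHO
        (∀ T' ∈ SH, IsProbabilityMeasure (μTHf T')) →  -- hprobHO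
        ∀ (𝔇 : Ch12Sec5.EllipticData (Gqs L v) ((UnitaryGroup.cmDatum L 2 (Matrix.of fun i j : Fin 2 => if i.val + j.val + 1 = 2 then (1 : L) else 0)).Local v × (UnitaryGroup.cmDatum L 1 (Matrix.of fun i j : Fin 1 => if i.val + j.val + 1 = 1 then (1 : L) else 0)).Local v)) (par : (IrrClass (Gqs L v) → ((((UnitaryGroup.LocalRing L v)ˣ →* ℂˣ) × (↥(normOneUnits (conjLocal L (IsCMField.complexConj L) v)) →* ℂˣ))))),
          𝔇.μG = νQv →  -- hC01
          𝔇.μH = νHv →  -- hC02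
          𝔇.μGZ = μZ →  -- hC03
          𝔇.orb = mQv →  -- hC04
          (∀ γ : Gqs L v, γ ∈ 𝔇.regG ↔ IsRegularElt (γ.val : GL (Fin 3) (UnitaryGroup.LocalRing L v))) →  -- hC05
          (∀ (φ : Gqs L v → ℂ) (fH : ((UnitaryGroup.cmDatum L 2 (Matrix.of fun i j : Fin 2 => if i.val + j.val + 1 = 2 then (1 : L) else 0)).Local v × (UnitaryGroup.cmDatum L 1 (Matrix.of fun i j : Fin 1 => if i.val + j.val + 1 = 1 then (1 : L) else 0)).Local v) → ℂ), 𝔇.IsTransfer φ fH ↔ IsLocalDeltaTransfer L (qsForm L) v ((finExplicitCollection L (qsForm L) μ (finExplicitDelta_conj_left_all L (qsForm L) μ) (finExplicitDelta_conj_right_all L (qsForm L) μ)) v) mHv mQv fH φ) →  -- hC06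
          ({πSt} : Finset (IrrClass (((UnitaryGroup.cmDatum L 2 (Matrix.of fun i j : Fin 2 => if i.val + j.val + 1 = 2 then (1 : L) else 0)).Local v × (UnitaryGroup.cmDatum L 1 (Matrix.of fun i j : Fin 1 => if i.val + j.val + 1 = 1 then (1 : L) else 0)).Local v)))) ∈ 𝔇.sqPacketsH →  -- hC07
          (∀ γ : Gqs L v, γ ∈ 𝔇.ellG ↔ IsRegularElt (γ.val : GL (Fin 3) (UnitaryGroup.LocalRing L v)) ∧ γ ∉ hyperbolicSet L v) →  -- hE
          (∀ π : IrrClass (Gqs L v), Measurable (𝔇.char π) ∧ LocallyIntegrable (𝔇.char π) 𝔇.μG ∧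
          (∀ x ∈ 𝔇.regG, ∀ᶠ y in 𝓝 x, 𝔇.char π y = 𝔇.char π x) ∧
          ∀ φ : Gqs L v → ℂ, IsLocSmooth φ → π.smoothTrace 𝔇.μG φ = ∫ x, φ x * 𝔇.char π x ∂𝔇.μG) →  -- hchar
          (∀ T : Subgroup (Gqs L v), T ∈ 𝔇.cartanAll ↔ T = (cmBorelTriple L 3 v).M ∨ T ∈ 𝔇.cartanG) →  -- hAll
          (𝔇.μT (cmBorelTriple L 3 v).M).IsHaarMeasure →  -- hHaar
          (∀ T ∈ 𝔇.cartanG, IsCompact (T : Set (Gqs L v)) ∧ ∃ γ₀ : Gqs L v, IsRegularElt (γ₀.val : GL (Fin 3) (UnitaryGroup.LocalRing L v)) ∧ T = Subgroup.centralizer ({γ₀} : Set (Gqs L v))) →  -- hcart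
          (∀ T ∈ 𝔇.cartanG, (𝔇.μT T).IsHaarMeasure) →  -- hHaarG
          (∀ T ∈ 𝔇.cartanG, IsFiniteMeasure (𝔇.μT T)) →  -- hfinG
          (∀ T ∈ 𝔇.cartanG, ∃ s : Finset (Subgroup ↥T), (∀ K ∈ s, IsClosed (K : Set ↥T) ∧ ¬ IsOpen (K : Set ↥T)) ∧ ∀ t : ↥T, ¬ IsRegularElt ((t : Gqs L v).val : GL (Fin 3) (UnitaryGroup.LocalRing L v)) → ∃ K ∈ s, t ∈ K) →  -- hker
          (∀ g : Gqs L v, 𝔇.DG g = ((NNReal.sqrt (NNReal.sqrt ((∏ w : PlacesOver L v, IsNonarchimedeanLocalField.normAbs (w.1.adicCompletion L) (((g.val : GL (Fin 3) (UnitaryGroup.LocalRing L v)).val.charpoly.discr) w)) * ((∏ w : PlacesOver L v, IsNonarchimedeanLocalField.normAbs (w.1.adicCompletion L) (((g.val : GL (Fin 3) (UnitaryGroup.LocalRing L v)).val.det) w)) ^ 2)⁻¹)) : ℝ≥0) : ℝ)) →  -- eDG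
          (∀ s : ((UnitaryGroup.cmDatum L 2 (Matrix.of fun i j : Fin 2 => if i.val + j.val + 1 = 2 then (1 : L) else 0)).Local v × (UnitaryGroup.cmDatum L 1 (Matrix.of fun i j : Fin 1 => if i.val + j.val + 1 = 1 then (1 : L) else 0)).Local v), 𝔇.DH s = ((NNReal.sqrt (NNReal.sqrt ((∏ w : PlacesOver L v, IsNonarchimedeanLocalField.normAbs (w.1.adicCompletion L) (((s.1.val : GL (Fin 2) (UnitaryGroup.LocalRing L v)).val.charpoly.discr) w)) * (∏ w : PlacesOver L v, IsNonarchimedeanLocalField.normAbs (w.1.adicCompletion L) (((s.1.val : GL (Fin 2) (UnitaryGroup.LocalRing L v)).val.det) w))⁻¹)) : ℝ≥0) : ℝ)) →  -- eDH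
          (∀ T ∈ 𝔇.cartanH, IsCompact (T : Set ((UnitaryGroup.cmDatum L 2 (Matrix.of fun i j : Fin 2 => if i.val + j.val + 1 = 2 then (1 : L) else 0)).Local v × (UnitaryGroup.cmDatum L 1 (Matrix.of fun i j : Fin 1 => if i.val + j.val + 1 = 1 then (1 : L) else 0)).Local v))) →  -- hKH
          (∀ T ∈ 𝔇.cartanH, IsFiniteMeasure (𝔇.μTH T)) →  -- hFH
          (∀ ρ ∈ 𝔇.sqPacketsH, ∀ T ∈ 𝔇.cartanH, ∀ C : Set ((UnitaryGroup.cmDatum L 2 (Matrix.of fun i j : Fin 2 => if i.val + j.val + 1 = 2 then (1 : L) else 0)).Local v × (UnitaryGroup.cmDatum L 1 (Matrix.of fun i j : Fin 1 => if i.val + j.val + 1 = 1 then (1 : L) else 0)).Local v), IsCompact C → C ⊆ (T : Set ((UnitaryGroup.cmDatum L 2 (Matrix.of fun i j : Fin 2 => if i.val + j.val + 1 = 2 then (1 : L) else 0)).Local v × (UnitaryGroup.cmDatum L 1 (Matrix.of fun i j : Fin 1 => if i.val + j.val + 1 = 1 then (1 : L) else 0)).Local v)) → ∃ B : ℝ,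 ∀ γ ∈ C, ‖(𝔇.DH γ : ℂ) * 𝔇.packetCharH ρ γ‖ ≤ B) →  -- hHBH
          (∀ π : IrrClass (Gqs L v), ¬ π.IsSquareIntegrable μZ → π.IsConstituentOf (UnitaryGroup.cmPrincipalSeries L 3 v (UnitaryGroup.cmTorusCharPair L v (par π).1 (par π).2)) ∧ Continuous (par π).1 ∧ Continuous (par π).2) →  -- hNL
          (∀ π : IrrClass (Gqs L v), (∃ (χ₁ : (UnitaryGroup.LocalRing L v)ˣ →* ℂˣ) (χ₂ : ↥(normOneUnits (conjLocal L (IsCMField.complexConj L) v)) →* ℂˣ), Continuous (fun x => ((χ₁ x : ℂˣ) : ℂ)) ∧ Continuous (fun x => ((χ₂ x : ℂˣ) : ℂ)) ∧ (UnitaryGroup.cmPrincipalSeries L 3 v (UnitaryGroup.cmTorusCharPair L v χ₁ χ₂)).IsIrreducible ∧ π.IsConstituentOf (UnitaryGroup.cmPrincipalSeries L 3 v (UnitaryGroup.cmTorusCharPair L v χ₁ χ₂))) → (UnitaryGroup.cmPrincipalSeries L 3 v (UnitaryGroup.cmTorusCharPair L v (par π).1 (par π).2)).IsIrreducible ∧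 π.IsConstituentOf (UnitaryGroup.cmPrincipalSeries L 3 v (UnitaryGroup.cmTorusCharPair L v (par π).1 (par π).2)) ∧ Continuous (par π).1 ∧ Continuous (par π).2 ∧ Continuous (fun x => (((par π).1 x : ℂˣ) : ℂ)) ∧ Continuous (fun x => (((par π).2 x : ℂˣ) : ℂ)) ∧ ∀ (ν : Measure (Gqs L v)) (f : Gqs L v → ℂ), π.smoothTrace ν f = Representation.smoothTrace (G := Gqs L v) (UnitaryGroup.cmPrincipalSeries L 3 v (UnitaryGroup.cmTorusCharPair L v (par π).1 (par π).2)) ν f) →  -- hPSpar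
          (∀ P : Finset (IrrClass (Gqs L v)), P ∈ 𝔇.ldsPackets ↔ (P.card = 2 ∧ ∃ (χ₁ : (UnitaryGroup.LocalRing L v)ˣ →* ℂˣ) (χ₂ : ↥(normOneUnits (conjLocal L (IsCMField.complexConj L) v)) →* ℂˣ), Continuous (fun x => ((χ₁ x : ℂˣ) : ℂ)) ∧ Continuous (fun x => ((χ₂ x : ℂˣ) : ℂ)) ∧ (∀ a : (UnitaryGroup.LocalRing L v)ˣ, (conjLocal L (IsCMField.complexConj L) v) (a : UnitaryGroup.LocalRing L v) = a → χ₁ a = 1) ∧ χ₁ ≠ 1 ∧ ∀ c : IrrClass (Gqs L v), c ∈ P ↔ c.IsConstituentOf (UnitaryGroup.cmPrincipalSeries L 3 v (UnitaryGroup.cmTorusCharPair L v χ₁ χ₂)))) →  -- hLdsF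
          (∀ (χ₁ : (UnitaryGroup.LocalRing L v)ˣ →* ℂˣ) (χ₂ : ↥(normOneUnits (conjLocal L (IsCMField.complexConj L) v)) →* ℂˣ), Continuous (fun x => ((χ₁ x : ℂˣ) : ℂ)) → Continuous (fun x => ((χ₂ x : ℂˣ) : ℂ)) → ∀ π π' : IrrClass (Gqs L v), ¬ π.IsSquareIntegrable μZ → ¬ π'.IsSquareIntegrable μZ → π.IsConstituentOf (UnitaryGroup.cmPrincipalSeries L 3 v (UnitaryGroup.cmTorusCharPair L v χ₁ χ₂)) → π'.IsConstituentOf (UnitaryGroup.cmPrincipalSeries L 3 v (UnitaryGroup.cmTorusCharPair L v χ₁ χ₂)) → par π = par π') →  -- hW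
          (∀ a b : ((UnitaryGroup.cmDatum L 2 (Matrix.of fun i j : Fin 2 => if i.val + j.val + 1 = 2 then (1 : L) else 0)).Local v × (UnitaryGroup.cmDatum L 1 (Matrix.of fun i j : Fin 1 => if i.val + j.val + 1 = 1 then (1 : L) else 0)).Local v), 𝔇.stConjH a b ↔ IsLocalStablyConjH L v a b) →  -- hStH
          (∀ a : ((UnitaryGroup.cmDatum L 2 (Matrix.of fun i j : Fin 2 => if i.val + j.val + 1 = 2 then (1 : L) else 0)).Local v × (UnitaryGroup.cmDatum L 1 (Matrix.of fun i j : Fin 1 => if i.val + j.val + 1 = 1 then (1 : L) else 0)).Local v), IsLocalGRegular L v a → a ∈ 𝔇.regH) →  -- hRegH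
          (∀ (α : ((UnitaryGroup.cmDatum L 2 (Matrix.of fun i j : Fin 2 => if i.val + j.val + 1 = 2 then (1 : L) else 0)).Local v × (UnitaryGroup.cmDatum L 1 (Matrix.of fun i j : Fin 1 => if i.val + j.val + 1 = 1 then (1 : L) else 0)).Local v) → ℂ) (x : Gqs L v), 𝔇.up α x = if IsRegularElt (x.val : GL (Fin 3) (UnitaryGroup.LocalRing L v)) then ((𝔇.DG x : ℂ))⁻¹ * ∑ᶠ q : Quot (IsLocalStablyConjH L v), (if IsLocalGRegular L v q.out ∧ IsLocalNormPair L (qsForm L) v q.out x then finTau L v q.out μ * (𝔇.DH q.out : ℂ) * ((finKappaAt L v (qsForm L) q.out x : ℤ) : ℂ) * α q.out else 0) else 0) →  -- hUp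
          (∀ ρ ∈ 𝔇.sqPacketsH, ∀ C : Set ((UnitaryGroup.cmDatum L 2 (Matrix.of fun i j : Fin 2 => if i.val + j.val + 1 = 2 then (1 : L) else 0)).Local v × (UnitaryGroup.cmDatum L 1 (Matrix.of fun i j : Fin 1 => if i.val + j.val + 1 = 1 then (1 : L) else 0)).Local v), IsCompact C → ∃ B : ℝ, ∀ s ∈ C, IsLocalGRegular L v s → ‖(𝔇.DH s : ℂ) * 𝔇.packetCharH ρ s‖ ≤ B) →  -- hHBHP
          (∀ ξ' : ((UnitaryGroup.cmDatum L 2 (Matrix.of fun i j : Fin 2 => if i.val + j.val + 1 = 2 then (1 : L) else 0)).Local v × (UnitaryGroup.cmDatum L 1 (Matrix.of fun i j : Fin 1 => if i.val + j.val + 1 = 1 then (1 : L) else 0)).Local v) →* ℂˣ, Continuous ξ' → ∃ (η₁ η₂ : ↥(normOneUnits (conjLocal L (IsCMField.complexConj L) v)) →* ℂˣ), Continuous (fun x => ((η₁ x : ℂˣ) : ℂ)) ∧ Continuous (fun x => ((η₂ x : ℂˣ) : ℂ)) ∧ KeysCaseTwoLabels L v (μ.semilocalComponent L v) η₁ η₂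 (𝔇.pi2 ξ') (𝔇.piN ξ')) →  -- hlabels
          (∀ ψ' : ↥(Subgroup.center (Gqs L v)) →* ℂˣ, Continuous ψ' → ∃ ψ : ↥(normOneUnits (conjLocal L (IsCMField.complexConj L) v)) →* ℂˣ, Continuous ψ ∧ 𝔇.stG ψ' ≠ 𝔇.detG ψ' ∧ ∀ c : IrrClass (Gqs L v), c.IsConstituentOf (UnitaryGroup.cmPrincipalSeries L 3 v (UnitaryGroup.cmTorusCharPair L v (halfModulusChar (UnitaryGroup.LocalRing L v) * halfModulusChar (UnitaryGroup.LocalRing L v))⁻¹ ψ)) ↔ (c = 𝔇.stG ψ' ∨ c = 𝔇.detG ψ')) →  -- hSt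
          (∀ ψ₀ : ↥(normOneUnits (conjLocal L (IsCMField.complexConj L) v)) →* ℂˣ, Continuous (fun x => ((ψ₀ x : ℂˣ) : ℂ)) → ∃ ψ : ↥(Subgroup.center (Gqs L v)) →* ℂˣ, Continuous ψ ∧ ∀ c : IrrClass (Gqs L v), c.IsConstituentOf (UnitaryGroup.cmPrincipalSeries L 3 v (UnitaryGroup.cmTorusCharPair L v (halfModulusChar (UnitaryGroup.LocalRing L v) * halfModulusChar (UnitaryGroup.LocalRing L v))⁻¹ ψ₀)) ↔ (c = 𝔇.stG ψ ∨ c = 𝔇.detG ψ)) →  -- hStJH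
          (∀ (η₁ η₂ : ↥(normOneUnits (conjLocal L (IsCMField.complexConj L) v)) →* ℂˣ), Continuous (fun x => ((η₁ x : ℂˣ) : ℂ)) → Continuous (fun x => ((η₂ x : ℂˣ) : ℂ)) → ∃ ξ' : ((UnitaryGroup.cmDatum L 2 (Matrix.of fun i j : Fin 2 => if i.val + j.val + 1 = 2 then (1 : L) else 0)).Local v × (UnitaryGroup.cmDatum L 1 (Matrix.of fun i j : Fin 1 => if i.val + j.val + 1 = 1 then (1 : L) else 0)).Local v) →* ℂˣ, Continuous ξ' ∧ KeysCaseTwoLabels L v (μ.semilocalComponent L v) η₁ η₂ (𝔇.pi2 ξ') (𝔇.piN ξ')) →  -- hKeysJH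
          (∀ ρ ∈ 𝔇.sqPacketsH, ∀ a : ((UnitaryGroup.cmDatum L 2 (Matrix.of fun i j : Fin 2 => if i.val + j.val + 1 = 2 then (1 : L) else 0)).Local v × (UnitaryGroup.cmDatum L 1 (Matrix.of fun i j : Fin 1 => if i.val + j.val + 1 = 1 then (1 : L) else 0)).Local v), IsLocalGRegular L v a → ∀ᶠ a' in 𝓝 a, 𝔇.packetCharH ρ a' = 𝔇.packetCharH ρ a) →  -- hM1lc
          (∀ γ : Gqs L v, IsRegularElt (γ.val : GL (Fin 3) (UnitaryGroup.LocalRing L v)) → ∃ T' ∈ 𝔇.cartanAll, ∃ x : Gqs L v, ∀ g : Gqs L v, g ∈ Subgroup.centralizer ({γ} : Set (Gqs L v)) ↔ x⁻¹ * g * x ∈ T') →  -- hcovA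
          (∀ T' ∈ 𝔇.cartanAll, ∀ T'' ∈ 𝔇.cartanAll, T' ≠ T'' → ∀ y : Gqs L v, ¬ ∀ h : Gqs L v, h ∈ T'' ↔ y⁻¹ * h * y ∈ T') →  -- hncA
          (∀ T' ∈ 𝔇.cartanAll, T' ≠ (cmBorelTriple L 3 v).M → IsCompact (T' : Set (Gqs L v))) →  -- hcptA
          (∀ T' ∈ 𝔇.cartanAll, (𝔇.μT T').IsInvInvariant) →  -- hinvT
          (∀ T' ∈ 𝔇.cartanAll, 𝔇.μT T' (compactCore ↥T') = 1) →  -- hcoreT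
          (∀ π ∈ 𝔇.irredPS, ∃ (χ₁ : (UnitaryGroup.LocalRing L v)ˣ →* ℂˣ) (χ₂ : ↥(normOneUnits (conjLocal L (IsCMField.complexConj L) v)) →* ℂˣ), Continuous (fun x => ((χ₁ x : ℂˣ) : ℂ)) ∧ Continuous (fun x => ((χ₂ x : ℂˣ) : ℂ)) ∧ (UnitaryGroup.cmPrincipalSeries L 3 v (UnitaryGroup.cmTorusCharPair L v χ₁ χ₂)).IsIrreducible ∧ π.IsConstituentOf (UnitaryGroup.cmPrincipalSeries L 3 v (UnitaryGroup.cmTorusCharPair L v χ₁ χ₂))) →  -- hIrr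
          (∀ ξ' : ((UnitaryGroup.cmDatum L 2 (Matrix.of fun i j : Fin 2 => if i.val + j.val + 1 = 2 then (1 : L) else 0)).Local v × (UnitaryGroup.cmDatum L 1 (Matrix.of fun i j : Fin 1 => if i.val + j.val + 1 = 1 then (1 : L) else 0)).Local v) →* ℂˣ, (𝔇.pi2 ξ').IsSquareIntegrable 𝔇.μGZ ∧ ¬ (𝔇.piN ξ').IsSquareIntegrable 𝔇.μGZ) →  -- hKeys
          𝔇.DetNotL2 →  -- hDet
          𝔇.PacketCharHRegularity →  -- hM1H
          (∀ ψ' : ↥(Subgroup.center (Gqs L v)) →* ℂˣ, Continuous ψ' → 𝔇.IsL2 (𝔇.stG ψ')) →  -- hStL2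
          𝔇.cartanG = Sell →  -- eCartanG
          (∀ T' : Subgroup (Gqs L v), 𝔇.μT T' = μTf T') →  -- eMuT
          𝔇.cartanH = SH →  -- eCartanH
          (∀ T' : Subgroup ((UnitaryGroup.cmDatum L 2 (Matrix.of fun i j : Fin 2 => if i.val + j.val + 1 = 2 then (1 : L) else 0)).Local v × (UnitaryGroup.cmDatum L 1 (Matrix.of fun i j : Fin 1 => if i.val + j.val + 1 = 1 then (1 : L) else 0)).Local v), 𝔇.μTH T' = μTHf T') →  -- eMuTH
          (∀ a : ((UnitaryGroup.cmDatum L 2 (Matrix.of fun i j : Fin 2 => if i.val + j.val + 1 = 2 then (1 : L) else 0)).Local v × (UnitaryGroup.cmDatum L 1 (Matrix.of fun i j : Fin 1 => if i.val + j.val + 1 = 1 then (1 : L) else 0)).Local v), a ∈ 𝔇.regH ↔ IsLocalGRegular L v a) →  -- eRegH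
          (∀ a : ((UnitaryGroup.cmDatum L 2 (Matrix.of fun i j : Fin 2 => if i.val + j.val + 1 = 2 then (1 : L) else 0)).Local v × (UnitaryGroup.cmDatum L 1 (Matrix.of fun i j : Fin 1 => if i.val + j.val + 1 = 1 then (1 : L) else 0)).Local v), a ∈ 𝔇.ellH ↔ IsLocalGRegular L v a ∧ IsCompact ((Subgroup.centralizer ({a} : Set ((UnitaryGroup.cmDatum L 2 (Matrix.of fun i j : Fin 2 => if i.val + j.val + 1 = 2 then (1 : L) else 0)).Local v × (UnitaryGroup.cmDatum L 1 (Matrix.of fun i j : Fin 1 => if i.val + j.val + 1 = 1 then (1 : L) else 0)).Local v)) : Subgroup ((UnitaryGroup.cmDatum L 2 (Matrix.of fun i j : Fin 2 => if i.val + j.val + 1 = 2 then (1 : L) else 0)).Local v × (UnitaryGroup.cmDatum L 1 (Matrix.of fun i j : Fin 1 => if i.val + j.val + 1 = 1 then (1 : L) else 0)).Local v)) : Set ((UnitaryGroup.cmDatum L 2 (Matrix.of fun i j : Fin 2 => if i.val + j.val + 1 = 2 then (1 : L) else 0)).Local v × (UnitaryGroup.cmDatum L 1 (Matrix.of fun i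 j : Fin 1 => if i.val + j.val + 1 = 1 then (1 : L) else 0)).Local v))) →  -- eEllH
          𝔇.sqPacketsH = {({πSt} : Finset (IrrClass ((UnitaryGroup.cmDatum L 2 (Matrix.of fun i j : Fin 2 => if i.val + j.val + 1 = 2 then (1 : L) else 0)).Local v × (UnitaryGroup.cmDatum L 1 (Matrix.of fun i j : Fin 1 => if i.val + j.val + 1 = 1 then (1 : L) else 0)).Local v)))} →  -- eSq
          (∀ π : IrrClass (Gqs L v), (∃ (χ₁ : (UnitaryGroup.LocalRing L v)ˣ →* ℂˣ) (χ₂ : ↥(normOneUnits (conjLocal L (IsCMField.complexConj L) v)) →* ℂˣ), Continuous (fun x => ((χ₁ x : ℂˣ) : ℂ)) ∧ Continuous (fun x => ((χ₂ x : ℂˣ) : ℂ)) ∧ (UnitaryGroup.cmPrincipalSeries L 3 v (UnitaryGroup.cmTorusCharPair L v χ₁ χ₂)).IsIrreducible ∧ π.IsConstituentOf (UnitaryGroup.cmPrincipalSeries L 3 v (UnitaryGroup.cmTorusCharPair L v χ₁ χ₂))) → π ∈ 𝔇.irredPS) →  -- eIrr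
          (∀ (η₁ η₂ : ↥(normOneUnits (conjLocal L (IsCMField.complexConj L) v)) →* ℂˣ), Continuous (fun x => ((η₁ x : ℂˣ) : ℂ)) → Continuous (fun x => ((η₂ x : ℂˣ) : ℂ)) → ∀ ξ' : ((UnitaryGroup.cmDatum L 2 (Matrix.of fun i j : Fin 2 => if i.val + j.val + 1 = 2 then (1 : L) else 0)).Local v × (UnitaryGroup.cmDatum L 1 (Matrix.of fun i j : Fin 1 => if i.val + j.val + 1 = 1 then (1 : L) else 0)).Local v) →* ℂˣ, (∀ hh : ((UnitaryGroup.cmDatum L 2 (Matrix.of fun i j : Fin 2 => if i.val + j.val + 1 = 2 then (1 : L) else 0)).Local v × (UnitaryGroup.cmDatum L 1 (Matrix.of fun i j : Fin 1 => if i.val + j.val + 1 = 1 then (1 : L) else 0)).Local v), ξ' hh = η₁ (localDet (IsCMField.complexConj L) v (isUnit_antidiagOne_det L 2) hh.1) * η₂ (localDet (IsCMField.complexConj L) v (isUnit_antidiagOne_det L 2) hh.1 * localDet (IsCMField.complexConj L) v (isUnit_antidiagOne_det L 1) hh.2)) → KeysCaseTwoLabels L v (μ.semilocalComponent L v) η₁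 η₂ (𝔇.pi2 ξ') (𝔇.piN ξ')) →  -- eLab
          (∀ ρ : IrrClass ((UnitaryGroup.cmDatum L 2 (Matrix.of fun i j : Fin 2 => if i.val + j.val + 1 = 2 then (1 : L) else 0)).Local v × (UnitaryGroup.cmDatum L 1 (Matrix.of fun i j : Fin 1 => if i.val + j.val + 1 = 1 then (1 : L) else 0)).Local v), 𝔇.charH ρ = 𝔇.charH πSt) →  -- eCharH
          (∃ (ιZ : ↥(normOneUnits (conjLocal L (IsCMField.complexConj L) v)) →* ↥(Subgroup.center (Gqs L v))) (detZ : (Gqs L v) →* ↥(Subgroup.center (Gqs L v))), Continuous ιZ ∧ Continuous detZ ∧ (∀ z : ↥(normOneUnits (conjLocal L (IsCMField.complexConj L) v)), ((ιZ z).val.val.val : Matrix (Fin 3) (Fin 3) (UnitaryGroup.LocalRing L v)) = (((z : (UnitaryGroup.LocalRing L v)ˣ) : UnitaryGroup.LocalRing L v)) • (1 : Matrix (Fin 3) (Fin 3) (UnitaryGroup.LocalRing L v))) ∧ (∀ g : (Gqs L v), ((detZ g).val.val.val : Matrix (Fin 3) (Fin 3) (UnitaryGroup.LocalRing L v)) =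 (g.val.val : Matrix (Fin 3) (Fin 3) (UnitaryGroup.LocalRing L v)).det • (1 : Matrix (Fin 3) (Fin 3) (UnitaryGroup.LocalRing L v))) ∧ ∀ ψ : ↥(Subgroup.center (Gqs L v)) →* ℂˣ, Continuous ψ → (∃ hopen : IsOpen (((ψ.comp detZ).ker : Subgroup (Gqs L v)) : Set (Gqs L v)), 𝔇.detG ψ = IrrClass.mk (SmoothIrrep.ofChar (ψ.comp detZ) hopen)) ∧ 𝔇.stG ψ ≠ 𝔇.detG ψ ∧ (∀ c : IrrClass (Gqs L v), c.IsConstituentOf (cmPrincipalSeries L 3 v (cmTorusCharPair L v (halfModulusChar (UnitaryGroup.LocalRing L v) * halfModulusChar (UnitaryGroup.LocalRing L v))⁻¹ (ψ.comp ιZ))) ↔ (c = 𝔇.stG ψ ∨ c = 𝔇.detG ψ)) ∧ (𝔇.stG ψ).IsSquareIntegrable μZ ∧ ¬ (𝔇.detG ψ).IsSquareIntegrable μZ) →  -- eSt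
          ((∀ π : IrrClass (Gqs L v), 𝔇.IsEllipticRep π → ¬ π.IsSupercuspidal → ¬ (Algebra.IsUnramifiedIn (𝓞 L) v.asIdeal ∨ Valued.v (2 : v.adicCompletion ↥(maximalRealSubfield L)) = 1) → ¬ ((Algebra.IsUnramifiedIn (𝓞 L) v.asIdeal ∨ Valued.v (2 : v.adicCompletion ↥(maximalRealSubfield L)) = 1) ∧ ∃ ψ : ↥(Subgroup.center (Gqs L v)) →* ℂˣ, Continuous ψ ∧ (π = 𝔇.stG ψ ∨ π = 𝔇.detG ψ)) → ∃ f : Gqs L v → ℂ, 𝔇.IsPseudoCoeff π f) ∧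
           (∀ σ : IrrClass (Gqs L v), 𝔇.IsL2 σ → ¬ σ.IsSupercuspidal → ¬ (Algebra.IsUnramifiedIn (𝓞 L) v.asIdeal ∨ Valued.v (2 : v.adicCompletion ↥(maximalRealSubfield L)) = 1) → ¬ ((Algebra.IsUnramifiedIn (𝓞 L) v.asIdeal ∨ Valued.v (2 : v.adicCompletion ↥(maximalRealSubfield L)) = 1) ∧ ∃ ψ : ↥(Subgroup.center (Gqs L v)) →* ℂˣ, Continuous ψ ∧ σ = 𝔇.stG ψ) → 𝔇.innerG (𝔇.char σ) (𝔇.char σ) = 1) ∧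
           (∀ π π' : IrrClass (Gqs L v), 𝔇.IsEllipticRep π → 𝔇.IsEllipticRep π' → ¬ π.IsSupercuspidal → ¬ π'.IsSupercuspidal → ¬ (Algebra.IsUnramifiedIn (𝓞 L) v.asIdeal ∨ Valued.v (2 : v.adicCompletion ↥(maximalRealSubfield L)) = 1) → ¬ ((Algebra.IsUnramifiedIn (𝓞 L) v.asIdeal ∨ Valued.v (2 : v.adicCompletion ↥(maximalRealSubfield L)) = 1) ∧ (∃ ψ : ↥(Subgroup.center (Gqs L v)) →* ℂˣ, Continuous ψ ∧ (π = 𝔇.stG ψ ∨ π = 𝔇.detG ψ)) ∧ (∃ ψ' : ↥(Subgroup.center (Gqs L v)) →* ℂˣ, Continuous ψ' ∧ (π' = 𝔇.stG ψ' ∨ π' = 𝔇.detG ψ'))) → 𝔇.innerG (𝔇.char π) (𝔇.char π') ≠ 0 → π ≠ π' → 𝔇.IsEllipticPair π π') ∧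
           (∀ P ∈ 𝔇.ldsPackets, ∀ π ∈ P, ¬ (Algebra.IsUnramifiedIn (𝓞 L) v.asIdeal ∨ Valued.v (2 : v.adicCompletion ↥(maximalRealSubfield L)) = 1) → 𝔇.innerG (𝔇.char π) (𝔇.char π) = 1) ∧
           𝔇.LdsPseudoCoeffTraceH ({πSt} : Finset (IrrClass (((UnitaryGroup.cmDatum L 2 (Matrix.of fun i j : Fin 2 => if i.val + j.val + 1 = 2 then (1 : L) else 0)).Local v × (UnitaryGroup.cmDatum L 1 (Matrix.of fun i j : Fin 1 => if i.val + j.val + 1 = 1 then (1 : L) else 0)).Local v)))) ∧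
           (∀ π : IrrClass (Gqs L v), 𝔇.IsL2 π → ¬ π.IsSupercuspidal → ¬ ((Algebra.IsUnramifiedIn (𝓞 L) v.asIdeal ∨ Valued.v (2 : v.adicCompletion ↥(maximalRealSubfield L)) = 1) ∧ ∃ ψ : ↥(Subgroup.center (Gqs L v)) →* ℂˣ, Continuous ψ ∧ π = 𝔇.stG ψ) → ∃ f : (Gqs L v) → ℂ, 𝔇.IsPseudoCoeff π f ∧ 0 < (f 1).re ∧ (f 1).im = 0))) →  -- hBlock
      ∃ (𝔇 : Ch12Sec5.EllipticData (Gqs L v) (((UnitaryGroup.cmDatum L 2 (Matrix.of fun i j : Fin 2 => if i.val + j.val + 1 = 2 then (1 : L) else 0)).Local v × (UnitaryGroup.cmDatum L 1 (Matrix.of fun i j : Fin 1 => if i.val + j.val + 1 = 1 then (1 : L) else 0)).Local v))) (d : IrrClass (Gqs L v) → ℝ) (T : Subgroup (Gqs L v))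
        (par : IrrClass (Gqs L v) → (((UnitaryGroup.LocalRing L v)ˣ →* ℂˣ) × (↥(normOneUnits (conjLocal L (IsCMField.complexConj L) v)) →* ℂˣ))) (μv : (UnitaryGroup.LocalRing L v)ˣ →* ℂˣ),
        𝔇.μG = νQv ∧  -- hC01
        𝔇.μH = νHv ∧  -- hC02
        𝔇.μGZ = μZ ∧  -- hC03
        𝔇.orb = mQv ∧  -- hC04
        (∀ γ : Gqs L v, γ ∈ 𝔇.regG ↔ IsRegularElt (γ.val : GL (Fin 3) (UnitaryGroup.LocalRing L v))) ∧  -- hC05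
        (∀ (φ : Gqs L v → ℂ) (fH : ((UnitaryGroup.cmDatum L 2 (Matrix.of fun i j : Fin 2 => if i.val + j.val + 1 = 2 then (1 : L) else 0)).Local v × (UnitaryGroup.cmDatum L 1 (Matrix.of fun i j : Fin 1 => if i.val + j.val + 1 = 1 then (1 : L) else 0)).Local v) → ℂ), 𝔇.IsTransfer φ fH ↔ IsLocalDeltaTransfer L (qsForm L) v ((finExplicitCollection L (qsForm L) μ (finExplicitDelta_conj_left_all L (qsForm L) μ) (finExplicitDelta_conj_right_all L (qsForm L) μ)) v) mHv mQv fH φ) ∧  -- hC06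
        ({πSt} : Finset (IrrClass (((UnitaryGroup.cmDatum L 2 (Matrix.of fun i j : Fin 2 => if i.val + j.val + 1 = 2 then (1 : L) else 0)).Local v × (UnitaryGroup.cmDatum L 1 (Matrix.of fun i j : Fin 1 => if i.val + j.val + 1 = 1 then (1 : L) else 0)).Local v)))) ∈ 𝔇.sqPacketsH ∧  -- hC07
        (∀ γ : Gqs L v, γ ∈ 𝔇.ellG ↔ IsRegularElt (γ.val : GL (Fin 3) (UnitaryGroup.LocalRing L v)) ∧ γ ∉ hyperbolicSet L v) ∧  -- hE
        (∀ π : IrrClass (Gqs L v), Measurable (𝔇.char π) ∧ LocallyIntegrable (𝔇.char π) 𝔇.μG ∧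
          (∀ x ∈ 𝔇.regG, ∀ᶠ y in 𝓝 x, 𝔇.char π y = 𝔇.char π x) ∧
          ∀ φ : Gqs L v → ℂ, IsLocSmooth φ → π.smoothTrace 𝔇.μG φ = ∫ x, φ x * 𝔇.char π x ∂𝔇.μG) ∧  -- hchar
        (∀ T : Subgroup (Gqs L v), T ∈ 𝔇.cartanAll ↔ T = (cmBorelTriple L 3 v).M ∨ T ∈ 𝔇.cartanG) ∧  -- hAll
        (𝔇.μT (cmBorelTriple L 3 v).M).IsHaarMeasure ∧  -- hHaar
        (∀ T ∈ 𝔇.cartanG, IsCompact (T : Set (Gqs L v)) ∧ ∃ γ₀ : Gqs L v, IsRegularElt (γ₀.val : GL (Fin 3) (UnitaryGroup.LocalRing L v)) ∧ T = Subgroup.centralizer ({γ₀} : Set (Gqs L v))) ∧  -- hcart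
        (∀ T ∈ 𝔇.cartanG, (𝔇.μT T).IsHaarMeasure) ∧  -- hHaarG
        (∀ T ∈ 𝔇.cartanG, IsFiniteMeasure (𝔇.μT T)) ∧  -- hfinG
        (∀ T ∈ 𝔇.cartanG, ∃ s : Finset (Subgroup ↥T), (∀ K ∈ s, IsClosed (K : Set ↥T) ∧ ¬ IsOpen (K : Set ↥T)) ∧ ∀ t : ↥T, ¬ IsRegularElt ((t : Gqs L v).val : GL (Fin 3) (UnitaryGroup.LocalRing L v)) → ∃ K ∈ s, t ∈ K) ∧  -- hker
        (∀ g : Gqs L v, 𝔇.DG g = ((NNReal.sqrt (NNReal.sqrt ((∏ w : PlacesOver L v, IsNonarchimedeanLocalField.normAbs (w.1.adicCompletion L) (((g.val : GL (Fin 3) (UnitaryGroup.LocalRing L v)).val.charpoly.discr) w)) * ((∏ w : PlacesOver L v, IsNonarchimedeanLocalField.normAbs (w.1.adicCompletion L) (((g.val : GL (Fin 3) (UnitaryGroup.LocalRing L v)).val.det) w)) ^ 2)⁻¹)) : ℝ≥0) : ℝ)) ∧  -- eDG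
        (∀ s : ((UnitaryGroup.cmDatum L 2 (Matrix.of fun i j : Fin 2 => if i.val + j.val + 1 = 2 then (1 : L) else 0)).Local v × (UnitaryGroup.cmDatum L 1 (Matrix.of fun i j : Fin 1 => if i.val + j.val + 1 = 1 then (1 : L) else 0)).Local v), 𝔇.DH s = ((NNReal.sqrt (NNReal.sqrt ((∏ w : PlacesOver L v, IsNonarchimedeanLocalField.normAbs (w.1.adicCompletion L) (((s.1.val : GL (Fin 2) (UnitaryGroup.LocalRing L v)).val.charpoly.discr) w)) * (∏ w : PlacesOver L v, IsNonarchimedeanLocalField.normAbs (w.1.adicCompletion L) (((s.1.val : GL (Fin 2) (UnitaryGroup.LocalRing L v)).val.det) w))⁻¹)) : ℝ≥0) : ℝ)) ∧  -- eDH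
        (∀ T ∈ 𝔇.cartanH, IsCompact (T : Set ((UnitaryGroup.cmDatum L 2 (Matrix.of fun i j : Fin 2 => if i.val + j.val + 1 = 2 then (1 : L) else 0)).Local v × (UnitaryGroup.cmDatum L 1 (Matrix.of fun i j : Fin 1 => if i.val + j.val + 1 = 1 then (1 : L) else 0)).Local v))) ∧  -- hKH
        (∀ T ∈ 𝔇.cartanH, IsFiniteMeasure (𝔇.μTH T)) ∧  -- hFH
        (∀ ρ ∈ 𝔇.sqPacketsH, ∀ T ∈ 𝔇.cartanH, ∀ C : Set ((UnitaryGroup.cmDatum L 2 (Matrix.of fun i j : Fin 2 => if i.val + j.val + 1 = 2 then (1 : L) else 0)).Local v × (UnitaryGroup.cmDatum L 1 (Matrix.of fun i j : Fin 1 => if i.val + j.val + 1 = 1 then (1 : L) else 0)).Local v), IsCompact C → C ⊆ (T : Set ((UnitaryGroup.cmDatum L 2 (Matrix.of fun i j : Fin 2 => if i.val + j.val + 1 = 2 then (1 : L) else 0)).Local v × (UnitaryGroup.cmDatum L 1 (Matrix.of fun i j : Fin 1 => if i.val + j.val + 1 = 1 then (1 : L) else 0)).Local v)) → ∃ B : ℝ,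 ∀ γ ∈ C, ‖(𝔇.DH γ : ℂ) * 𝔇.packetCharH ρ γ‖ ≤ B) ∧  -- hHBH
        (∀ π : IrrClass (Gqs L v), ¬ π.IsSquareIntegrable μZ → π.IsConstituentOf (UnitaryGroup.cmPrincipalSeries L 3 v (UnitaryGroup.cmTorusCharPair L v (par π).1 (par π).2)) ∧ Continuous (par π).1 ∧ Continuous (par π).2) ∧  -- hNL
        (∀ π : IrrClass (Gqs L v), (∃ (χ₁ : (UnitaryGroup.LocalRing L v)ˣ →* ℂˣ) (χ₂ : ↥(normOneUnits (conjLocal L (IsCMField.complexConj L) v)) →* ℂˣ), Continuous (fun x => ((χ₁ x : ℂˣ) : ℂ)) ∧ Continuous (fun x => ((χ₂ x : ℂˣ) : ℂ)) ∧ (UnitaryGroup.cmPrincipalSeries L 3 v (UnitaryGroup.cmTorusCharPair L v χ₁ χ₂)).IsIrreducible ∧ π.IsConstituentOf (UnitaryGroup.cmPrincipalSeries L 3 v (UnitaryGroup.cmTorusCharPair L v χ₁ χ₂))) → (UnitaryGroup.cmPrincipalSeries L 3 v (UnitaryGroup.cmTorusCharPair L v (par π).1 (par π).2)).IsIrreducible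 ∧ π.IsConstituentOf (UnitaryGroup.cmPrincipalSeries L 3 v (UnitaryGroup.cmTorusCharPair L v (par π).1 (par π).2)) ∧ Continuous (par π).1 ∧ Continuous (par π).2 ∧ Continuous (fun x => (((par π).1 x : ℂˣ) : ℂ)) ∧ Continuous (fun x => (((par π).2 x : ℂˣ) : ℂ)) ∧ ∀ (ν : Measure (Gqs L v)) (f : Gqs L v → ℂ), π.smoothTrace ν f = Representation.smoothTrace (G := Gqs L v) (UnitaryGroup.cmPrincipalSeries L 3 v (UnitaryGroup.cmTorusCharPair L v (par π).1 (par π).2)) ν f) ∧  -- hPSpar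
        (∀ P : Finset (IrrClass (Gqs L v)), P ∈ 𝔇.ldsPackets ↔ (P.card = 2 ∧ ∃ (χ₁ : (UnitaryGroup.LocalRing L v)ˣ →* ℂˣ) (χ₂ : ↥(normOneUnits (conjLocal L (IsCMField.complexConj L) v)) →* ℂˣ), Continuous (fun x => ((χ₁ x : ℂˣ) : ℂ)) ∧ Continuous (fun x => ((χ₂ x : ℂˣ) : ℂ)) ∧ (∀ a : (UnitaryGroup.LocalRing L v)ˣ, (conjLocal L (IsCMField.complexConj L) v) (a : UnitaryGroup.LocalRing L v) = a → χ₁ a = 1) ∧ χ₁ ≠ 1 ∧ ∀ c : IrrClass (Gqs L v), c ∈ P ↔ c.IsConstituentOf (UnitaryGroup.cmPrincipalSeries L 3 v (UnitaryGroup.cmTorusCharPair L v χ₁ χ₂)))) ∧  -- hLdsF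
        (∀ (χ₁ : (UnitaryGroup.LocalRing L v)ˣ →* ℂˣ) (χ₂ : ↥(normOneUnits (conjLocal L (IsCMField.complexConj L) v)) →* ℂˣ), Continuous (fun x => ((χ₁ x : ℂˣ) : ℂ)) → Continuous (fun x => ((χ₂ x : ℂˣ) : ℂ)) → ∀ π π' : IrrClass (Gqs L v), ¬ π.IsSquareIntegrable μZ → ¬ π'.IsSquareIntegrable μZ → π.IsConstituentOf (UnitaryGroup.cmPrincipalSeries L 3 v (UnitaryGroup.cmTorusCharPair L v χ₁ χ₂)) → π'.IsConstituentOf (UnitaryGroup.cmPrincipalSeries L 3 v (UnitaryGroup.cmTorusCharPair L v χ₁ χ₂)) → par π = par π') ∧  -- hW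
        UnitaryGroup.IsQuadraticCharExtension (conjLocal L (IsCMField.complexConj L) v) μv ∧  -- hμq
        (Continuous (fun x => ((μv x : ℂˣ) : ℂ))) ∧  -- hμc
        (∀ a b : ((UnitaryGroup.cmDatum L 2 (Matrix.of fun i j : Fin 2 => if i.val + j.val + 1 = 2 then (1 : L) else 0)).Local v × (UnitaryGroup.cmDatum L 1 (Matrix.of fun i j : Fin 1 => if i.val + j.val + 1 = 1 then (1 : L) else 0)).Local v), 𝔇.stConjH a b ↔ IsLocalStablyConjH L v a b) ∧  -- hStH
        (∀ a : ((UnitaryGroup.cmDatum L 2 (Matrix.of fun i j : Fin 2 => if i.val + j.val + 1 = 2 then (1 : L) else 0)).Local v × (UnitaryGroup.cmDatum L 1 (Matrix.of fun i j : Fin 1 => if i.val + j.val + 1 = 1 then (1 : L) else 0)).Local v), IsLocalGRegular L v a → a ∈ 𝔇.regH) ∧  -- hRegH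
        (∀ (α : ((UnitaryGroup.cmDatum L 2 (Matrix.of fun i j : Fin 2 => if i.val + j.val + 1 = 2 then (1 : L) else 0)).Local v × (UnitaryGroup.cmDatum L 1 (Matrix.of fun i j : Fin 1 => if i.val + j.val + 1 = 1 then (1 : L) else 0)).Local v) → ℂ) (x : Gqs L v), 𝔇.up α x = if IsRegularElt (x.val : GL (Fin 3) (UnitaryGroup.LocalRing L v)) then ((𝔇.DG x : ℂ))⁻¹ * ∑ᶠ q : Quot (IsLocalStablyConjH L v), (if IsLocalGRegular L v q.out ∧ IsLocalNormPair L (qsForm L) v q.out x then finTau L v q.out μ * (𝔇.DH q.out : ℂ) * ((finKappaAt L v (qsForm L) q.out x : ℤ) : ℂ) * α q.out else 0) else 0) ∧  -- hUp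
        (∀ ρ ∈ 𝔇.sqPacketsH, ∀ C : Set ((UnitaryGroup.cmDatum L 2 (Matrix.of fun i j : Fin 2 => if i.val + j.val + 1 = 2 then (1 : L) else 0)).Local v × (UnitaryGroup.cmDatum L 1 (Matrix.of fun i j : Fin 1 => if i.val + j.val + 1 = 1 then (1 : L) else 0)).Local v), IsCompact C → ∃ B : ℝ, ∀ s ∈ C, IsLocalGRegular L v s → ‖(𝔇.DH s : ℂ) * 𝔇.packetCharH ρ s‖ ≤ B) ∧  -- hHBHP
        (∃ (c : ℝ) (_ : c ≠ 0) (ι : Type) (S : Finset ι) (Λ : ι → ((Gqs L v) → ℂ) → ℂ) (Γ : ι → (Gqs L v) → ℂ) (γseq : ℕ → Gqs L v) (q : ℂ) (a : ι → ℕ) (g : ι → ℂ), (∀ f : (Gqs L v) → ℂ, IsLocSmooth f → ∀ᶠ γ in 𝓝[((T : Set (Gqs L v)) ∩ {γ | IsRegularElt (γ.val : GL (Fin 3) (UnitaryGroup.LocalRing L v))})] (1 : Gqs L v), classOrbitalIntegral mQv f (ConjClasses.mk γ) = (c : ℂ) * f 1 + ∑ u ∈ S, Λ u f * Γ u γ)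 ∧ (∀ n, γseq n ∈ (T : Set (Gqs L v)) ∧ IsRegularElt ((γseq n).val : GL (Fin 3) (UnitaryGroup.LocalRing L v))) ∧ Tendsto γseq atTop (𝓝 (1 : Gqs L v)) ∧ 1 < ‖q‖ ∧ (∀ u ∈ S, 1 ≤ a u) ∧ ∀ u ∈ S, ∀ n, Γ u (γseq n) = q ^ (n * a u) * g u) ∧  -- hGerm
        (∀ ξ' : ((UnitaryGroup.cmDatum L 2 (Matrix.of fun i j : Fin 2 => if i.val + j.val + 1 = 2 then (1 : L) else 0)).Local v × (UnitaryGroup.cmDatum L 1 (Matrix.of fun i j : Fin 1 => if i.val + j.val + 1 = 1 then (1 : L) else 0)).Local v) →* ℂˣ, Continuous ξ' → ∃ (η₁ η₂ : ↥(normOneUnits (conjLocal L (IsCMField.complexConj L) v)) →* ℂˣ), Continuous (fun x => ((η₁ x : ℂˣ) : ℂ)) ∧ Continuous (fun x => ((η₂ x : ℂˣ) : ℂ)) ∧ KeysCaseTwoLabels L v μv η₁ η₂ (𝔇.pi2 ξ') (𝔇.piN ξ')) ∧  -- hlabels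
        (∀ ψ' : ↥(Subgroup.center (Gqs L v)) →* ℂˣ, Continuous ψ' → ∃ ψ : ↥(normOneUnits (conjLocal L (IsCMField.complexConj L) v)) →* ℂˣ, Continuous ψ ∧ 𝔇.stG ψ' ≠ 𝔇.detG ψ' ∧ ∀ c : IrrClass (Gqs L v), c.IsConstituentOf (UnitaryGroup.cmPrincipalSeries L 3 v (UnitaryGroup.cmTorusCharPair L v (halfModulusChar (UnitaryGroup.LocalRing L v) * halfModulusChar (UnitaryGroup.LocalRing L v))⁻¹ ψ)) ↔ (c = 𝔇.stG ψ' ∨ c = 𝔇.detG ψ')) ∧  -- hSt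
        (∀ ψ₀ : ↥(normOneUnits (conjLocal L (IsCMField.complexConj L) v)) →* ℂˣ, Continuous (fun x => ((ψ₀ x : ℂˣ) : ℂ)) → ∃ ψ : ↥(Subgroup.center (Gqs L v)) →* ℂˣ, Continuous ψ ∧ ∀ c : IrrClass (Gqs L v), c.IsConstituentOf (UnitaryGroup.cmPrincipalSeries L 3 v (UnitaryGroup.cmTorusCharPair L v (halfModulusChar (UnitaryGroup.LocalRing L v) * halfModulusChar (UnitaryGroup.LocalRing L v))⁻¹ ψ₀)) ↔ (c = 𝔇.stG ψ ∨ c = 𝔇.detG ψ)) ∧  -- hStJH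
        (∀ (η₁ η₂ : ↥(normOneUnits (conjLocal L (IsCMField.complexConj L) v)) →* ℂˣ), Continuous (fun x => ((η₁ x : ℂˣ) : ℂ)) → Continuous (fun x => ((η₂ x : ℂˣ) : ℂ)) → ∃ ξ' : ((UnitaryGroup.cmDatum L 2 (Matrix.of fun i j : Fin 2 => if i.val + j.val + 1 = 2 then (1 : L) else 0)).Local v × (UnitaryGroup.cmDatum L 1 (Matrix.of fun i j : Fin 1 => if i.val + j.val + 1 = 1 then (1 : L) else 0)).Local v) →* ℂˣ, Continuous ξ' ∧ KeysCaseTwoLabels L v μv η₁ η₂ (𝔇.pi2 ξ') (𝔇.piN ξ')) ∧  -- hKeysJH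
        (∀ ρ ∈ 𝔇.sqPacketsH, ∀ a : ((UnitaryGroup.cmDatum L 2 (Matrix.of fun i j : Fin 2 => if i.val + j.val + 1 = 2 then (1 : L) else 0)).Local v × (UnitaryGroup.cmDatum L 1 (Matrix.of fun i j : Fin 1 => if i.val + j.val + 1 = 1 then (1 : L) else 0)).Local v), IsLocalGRegular L v a → ∀ᶠ a' in 𝓝 a, 𝔇.packetCharH ρ a' = 𝔇.packetCharH ρ a) ∧  -- hM1lc
        (∀ γ : Gqs L v, IsRegularElt (γ.val : GL (Fin 3) (UnitaryGroup.LocalRing L v)) → ∃ T' ∈ 𝔇.cartanAll, ∃ x : Gqs L v, ∀ g : Gqs L v, g ∈ Subgroup.centralizer ({γ} : Set (Gqs L v)) ↔ x⁻¹ * g * x ∈ T') ∧  -- hcovA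
        (∀ T' ∈ 𝔇.cartanAll, ∀ T'' ∈ 𝔇.cartanAll, T' ≠ T'' → ∀ y : Gqs L v, ¬ ∀ h : Gqs L v, h ∈ T'' ↔ y⁻¹ * h * y ∈ T') ∧  -- hncA
        (∀ T' ∈ 𝔇.cartanAll, T' ≠ (cmBorelTriple L 3 v).M → IsCompact (T' : Set (Gqs L v))) ∧  -- hcptA
        (∀ T' ∈ 𝔇.cartanAll, (𝔇.μT T').IsInvInvariant) ∧  -- hinvT
        (∀ T' ∈ 𝔇.cartanAll, 𝔇.μT T' (compactCore ↥T') = 1) ∧  -- hcoreT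
        (∀ π ∈ 𝔇.irredPS, ∃ (χ₁ : (UnitaryGroup.LocalRing L v)ˣ →* ℂˣ) (χ₂ : ↥(normOneUnits (conjLocal L (IsCMField.complexConj L) v)) →* ℂˣ), Continuous (fun x => ((χ₁ x : ℂˣ) : ℂ)) ∧ Continuous (fun x => ((χ₂ x : ℂˣ) : ℂ)) ∧ (UnitaryGroup.cmPrincipalSeries L 3 v (UnitaryGroup.cmTorusCharPair L v χ₁ χ₂)).IsIrreducible ∧ π.IsConstituentOf (UnitaryGroup.cmPrincipalSeries L 3 v (UnitaryGroup.cmTorusCharPair L v χ₁ χ₂))) ∧  -- hIrr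
        (∀ ξ' : ((UnitaryGroup.cmDatum L 2 (Matrix.of fun i j : Fin 2 => if i.val + j.val + 1 = 2 then (1 : L) else 0)).Local v × (UnitaryGroup.cmDatum L 1 (Matrix.of fun i j : Fin 1 => if i.val + j.val + 1 = 1 then (1 : L) else 0)).Local v) →* ℂˣ, (𝔇.pi2 ξ').IsSquareIntegrable 𝔇.μGZ ∧ ¬ (𝔇.piN ξ').IsSquareIntegrable 𝔇.μGZ) ∧  -- hKeys
        (∀ γ ∈ T, IsRegularElt (γ.val : GL (Fin 3) (UnitaryGroup.LocalRing L v)) → ∀ c : UnitaryGroup.LocalRing L v, ¬ ((γ.val.val : Matrix (Fin 3) (Fin 3) (UnitaryGroup.LocalRing L v)).charpoly).IsRoot c) ∧  -- hT3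
        𝔇.DetNotL2 ∧  -- hDet
        (∀ (χ₁ : (UnitaryGroup.LocalRing L v)ˣ →* ℂˣ) (χ₂ : ↥(normOneUnits (conjLocal L (IsCMField.complexConj L) v)) →* ℂˣ), Continuous (fun x => ((χ₁ x : ℂˣ) : ℂ)) → Continuous (fun x => ((χ₂ x : ℂˣ) : ℂ)) → (∃ N : Subrepresentation (UnitaryGroup.cmPrincipalSeries L 3 v (UnitaryGroup.cmTorusCharPair L v χ₁ χ₂)), N ≠ ⊥ ∧ N ≠ ⊤) → (χ₁ = halfModulusChar (UnitaryGroup.LocalRing L v) * halfModulusChar (UnitaryGroup.LocalRing L v) ∨ χ₁ = (halfModulusChar (UnitaryGroup.LocalRing L v) * halfModulusChar (UnitaryGroup.LocalRing L v))⁻¹) ∨ (∃ η : (UnitaryGroup.LocalRing L v)ˣ →* ℂˣ, IsQuadraticCharExtension (conjLocal L (IsCMField.complexConj L) v) η ∧ Continuous (fun x => ((η x : ℂˣ) : ℂ)) ∧ (χ₁ = η * halfModulusChar (UnitaryGroup.LocalRing L v) ∨ χ₁ = η * (halfModulusChar (UnitaryGroup.LocalRing L v))⁻¹)) ∨ (χ₁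 ≠ 1 ∧ ∀ a : (UnitaryGroup.LocalRing L v)ˣ, (conjLocal L (IsCMField.complexConj L) v) (a : UnitaryGroup.LocalRing L v) = a → χ₁ a = 1)) ∧  -- hKeysRed
        (∀ (χ₁ : (UnitaryGroup.LocalRing L v)ˣ →* ℂˣ) (χ₂ : ↥(normOneUnits (conjLocal L (IsCMField.complexConj L) v)) →* ℂˣ), Continuous (fun x => ((χ₁ x : ℂˣ) : ℂ)) → Continuous (fun x => ((χ₂ x : ℂˣ) : ℂ)) → (∀ a : (UnitaryGroup.LocalRing L v)ˣ, (conjLocal L (IsCMField.complexConj L) v) (a : UnitaryGroup.LocalRing L v) = a → χ₁ a = 1) → χ₁ ≠ 1 → ∃ P : Finset (IrrClass (Gqs L v)), P.card = 2 ∧ ∀ c : IrrClass (Gqs L v), c ∈ P ↔ c.IsConstituentOf (UnitaryGroup.cmPrincipalSeries L 3 v (UnitaryGroup.cmTorusCharPair L v χ₁ χ₂))) ∧  -- hLdsTwo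
        LocallyIntegrable (fun x : Gqs L v => (𝔇.DG x)⁻¹) 𝔇.μG ∧  -- hDGli
        𝔇.Prop1252 ∧  -- h1252
        (∀ π : IrrClass (Gqs L v), 𝔇.IsEllipticRep π → ¬ π.IsSupercuspidal → ¬ (Algebra.IsUnramifiedIn (𝓞 L) v.asIdeal ∨ Valued.v (2 : v.adicCompletion ↥(maximalRealSubfield L)) = 1) → ¬ ((Algebra.IsUnramifiedIn (𝓞 L) v.asIdeal ∨ Valued.v (2 : v.adicCompletion ↥(maximalRealSubfield L)) = 1) ∧ ∃ ψ : ↥(Subgroup.center (Gqs L v)) →* ℂˣ, Continuous ψ ∧ (π = 𝔇.stG ψ ∨ π = 𝔇.detG ψ)) → ∃ f : Gqs L v → ℂ, 𝔇.IsPseudoCoeff π f) ∧  -- hPCEnsNWR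
        (∀ σ : IrrClass (Gqs L v), 𝔇.IsL2 σ → ¬ σ.IsSupercuspidal → ¬ (Algebra.IsUnramifiedIn (𝓞 L) v.asIdeal ∨ Valued.v (2 : v.adicCompletion ↥(maximalRealSubfield L)) = 1) → ¬ ((Algebra.IsUnramifiedIn (𝓞 L) v.asIdeal ∨ Valued.v (2 : v.adicCompletion ↥(maximalRealSubfield L)) = 1) ∧ ∃ ψ : ↥(Subgroup.center (Gqs L v)) →* ℂˣ, Continuous ψ ∧ σ = 𝔇.stG ψ) → 𝔇.innerG (𝔇.char σ) (𝔇.char σ) = 1) ∧  -- hL2oneNsNWR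
        (∀ π π' : IrrClass (Gqs L v), 𝔇.IsEllipticRep π → 𝔇.IsEllipticRep π' → ¬ π.IsSupercuspidal → ¬ π'.IsSupercuspidal → ¬ (Algebra.IsUnramifiedIn (𝓞 L) v.asIdeal ∨ Valued.v (2 : v.adicCompletion ↥(maximalRealSubfield L)) = 1) → ¬ ((Algebra.IsUnramifiedIn (𝓞 L) v.asIdeal ∨ Valued.v (2 : v.adicCompletion ↥(maximalRealSubfield L)) = 1) ∧ (∃ ψ : ↥(Subgroup.center (Gqs L v)) →* ℂˣ, Continuous ψ ∧ (π = 𝔇.stG ψ ∨ π = 𝔇.detG ψ)) ∧ (∃ ψ' : ↥(Subgroup.center (Gqs L v)) →* ℂˣ, Continuous ψ' ∧ (π' = 𝔇.stG ψ' ∨ π' = 𝔇.detG ψ'))) → 𝔇.innerG (𝔇.char π) (𝔇.char π') ≠ 0 → π ≠ π' → 𝔇.IsEllipticPair π π') ∧  -- h61bNsEPR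
        (∀ P ∈ 𝔇.ldsPackets, ∀ π ∈ P, ¬ (Algebra.IsUnramifiedIn (𝓞 L) v.asIdeal ∨ Valued.v (2 : v.adicCompletion ↥(maximalRealSubfield L)) = 1) → 𝔇.innerG (𝔇.char π) (𝔇.char π) = 1) ∧  -- hLdsOneR
        𝔇.PacketCharHRegularity ∧  -- hM1H
        𝔇.PacketCharHNorm ∧  -- hM5
        𝔇.LdsPseudoCoeffTraceH ({πSt} : Finset (IrrClass (((UnitaryGroup.cmDatum L 2 (Matrix.of fun i j : Fin 2 => if i.val + j.val + 1 = 2 then (1 : L) else 0)).Local v × (UnitaryGroup.cmDatum L 1 (Matrix.of fun i j : Fin 1 => if i.val + j.val + 1 = 1 then (1 : L) else 0)).Local v)))) ∧  -- hR0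
        (∀ ψ' : ↥(Subgroup.center (Gqs L v)) →* ℂˣ, Continuous ψ' → 𝔇.IsL2 (𝔇.stG ψ')) ∧  -- hStL2
        (∀ (π : IrrClass (Gqs L v)) (f : Gqs L v → ℂ), 𝔇.IsL2 π → 𝔇.IsPseudoCoeff π f → f 1 = (d π : ℂ)) ∧  -- hPL
        (∀ π : IrrClass (Gqs L v), 𝔇.IsL2 π → 0 < d π) ∧  -- hdpos
        normalizedCharacter_locallyBounded ∧  -- hHCB
        (∀ π : IrrClass (Gqs L v), (∃ (χ₁ : (UnitaryGroup.LocalRing L v)ˣ →* ℂˣ) (χ₂ : ↥(normOneUnits (conjLocal L (IsCMField.complexConj L) v)) →* ℂˣ), Continuous (fun x => ((χ₁ x : ℂˣ) : ℂ)) ∧ Continuous (fun x => ((χ₂ x : ℂˣ) : ℂ)) ∧ (UnitaryGroup.cmPrincipalSeries L 3 v (UnitaryGroup.cmTorusCharPair L v χ₁ χ₂)).IsIrreducible ∧ π.IsConstituentOf (UnitaryGroup.cmPrincipalSeries L 3 v (UnitaryGroup.cmTorusCharPair L v χ₁ χ₂))) → π ∈ 𝔇.irredPS) ∧  -- eIr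r
        (∃ (ιZ : ↥(normOneUnits (conjLocal L (IsCMField.complexConj L) v)) →* ↥(Subgroup.center (Gqs L v))) (detZ : (Gqs L v) →* ↥(Subgroup.center (Gqs L v))), Continuous ιZ ∧ Continuous detZ ∧ (∀ z : ↥(normOneUnits (conjLocal L (IsCMField.complexConj L) v)), ((ιZ z).val.val.val : Matrix (Fin 3) (Fin 3) (UnitaryGroup.LocalRing L v)) = (((z : (UnitaryGroup.LocalRing L v)ˣ) : UnitaryGroup.LocalRing L v)) • (1 : Matrix (Fin 3) (Fin 3) (UnitaryGroup.LocalRing L v))) ∧ (∀ g : (Gqs L v), ((detZ g).val.val.val : Matrix (Fin 3) (Fin 3) (UnitaryGroup.LocalRing L v)) = (g.val.val : Matrix (Fin 3) (Fin 3) (UnitaryGroup.LocalRing L v)).det • (1 : Matrix (Fin 3) (Fin 3) (UnitaryGroup.LocalRing L v))) ∧ ∀ ψ : ↥(Subgroup.center (Gqs L v)) →* ℂˣ, Continuous ψ → (∃ hopen : IsOpen (((ψ.comp detZ).ker : Subgroup (Gqs L v)) : Set (Gqs L v)), 𝔇.detG ψ = IrrClass.mk (SmoothIrrep.ofChar (ψ.comp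 detZ) hopen)) ∧ 𝔇.stG ψ ≠ 𝔇.detG ψ ∧ (∀ c : IrrClass (Gqs L v), c.IsConstituentOf (cmPrincipalSeries L 3 v (cmTorusCharPair L v (halfModulusChar (UnitaryGroup.LocalRing L v) * halfModulusChar (UnitaryGroup.LocalRing L v))⁻¹ (ψ.comp ιZ))) ↔ (c = 𝔇.stG ψ ∨ c = 𝔇.detG ψ)) ∧ (𝔇.stG ψ).IsSquareIntegrable μZ ∧ ¬ (𝔇.detG ψ).IsSquareIntegrable μZ) ∧  -- eSt
        (∀ a : ((UnitaryGroup.cmDatum L 2 (Matrix.of fun i j : Fin 2 => if i.val + j.val + 1 = 2 then (1 : L) else 0)).Local v × (UnitaryGroup.cmDatum L 1 (Matrix.of fun i j : Fin 1 => if i.val + j.val + 1 = 1 then (1 : L) else 0)).Local v), a ∈ 𝔇.regH ↔ IsLocalGRegular L v a)  -- eRegH (EXPORTED block EXTRA)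
    := by
  intro L _ _ _ μ ξ v hns hμu hμω _ _ _ _ νHv νQv _ _ _ _ mHv mQv hcanH hcanQ hT_v π₁ πSt hlab hπ₁ _ _ μZ _ hHC hHCB T hT3 hGerm hKeysRed hBlock'
  classical
  -- ★ INSTANTIATE-CARTAN: the Cartan data and their twelve binders
  obtain ⟨Sell, μTf, SH, μTHf, hcartO, hcovGO, hncGO, hHaarGO, hcoreGO, hinvGO, hHaarMO, hcoreMO, hinvMO, hKHO, hcovHO, hncHO, hHaarHO, hprobHO⟩ := F0P3cStCharTSRung0Cartan.exists_cartanInputs₂ L v hns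
  have hBlock := hBlock' Sell μTf SH μTHf hcartO hcovGO hncGO hHaarGO hcoreGO hHaarMO hcoreMO hKHO hcovHO hncHO hHaarHO hprobHO
  -- keep the (large) goal out of the tactic state while the datum is built: argue by contradiction and produce the witness at the end
  by_contra hneg
  letI : ∀ a : ((UnitaryGroup.cmDatum L 2 (Matrix.of fun i j : Fin 2 => if i.val + j.val + 1 = 2 then (1 : L) else 0)).Local v × (UnitaryGroup.cmDatum L 1 (Matrix.of fun i j : Fin 1 => if i.val + j.val + 1 = 1 then (1 : L) else 0)).Local v), MeasurableSpace (((UnitaryGroup.cmDatum L 2 (Matrix.of fun i j : Fin 2 => if i.val + j.val + 1 = 2 then (1 : L) else 0)).Local v × (UnitaryGroup.cmDatum L 1 (Matrix.of fun i j : Fin 1 => if i.val + j.val + 1 = 1 then (1 : L) else 0)).Local v) ⧸ Subgroup.centralizer ({a} : Set ((UnitaryGroup.cmDatum L 2 (Matrix.of fun i j : Fin 2 => if i.val + j.val + 1 = 2 then (1 : L) else 0)).Local v × (UnitaryGroup.cmDatum L 1 (Matrix.of fun i j : Fin 1 => if i.val + j.val + 1 = 1 then (1 : L) else 0)).Local v)))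 := fun _ => borel _
  haveI : ∀ a : ((UnitaryGroup.cmDatum L 2 (Matrix.of fun i j : Fin 2 => if i.val + j.val + 1 = 2 then (1 : L) else 0)).Local v × (UnitaryGroup.cmDatum L 1 (Matrix.of fun i j : Fin 1 => if i.val + j.val + 1 = 1 then (1 : L) else 0)).Local v), BorelSpace (((UnitaryGroup.cmDatum L 2 (Matrix.of fun i j : Fin 2 => if i.val + j.val + 1 = 2 then (1 : L) else 0)).Local v × (UnitaryGroup.cmDatum L 1 (Matrix.of fun i j : Fin 1 => if i.val + j.val + 1 = 1 then (1 : L) else 0)).Local v) ⧸ Subgroup.centralizer ({a} : Set ((UnitaryGroup.cmDatum L 2 (Matrix.of fun i j : Fin 2 => if i.val + j.val + 1 = 2 then (1 : L) else 0)).Local v × (UnitaryGroup.cmDatum L 1 (Matrix.of fun i j : Fin 1 => if i.val + j.val + 1 = 1 then (1 : L) else 0)).Local v))) := fun _ => ⟨rfl⟩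
  letI : ∀ γ : Gqs L v, MeasurableSpace (Gqs L v ⧸ Subgroup.centralizer ({γ} : Set (Gqs L v))) := fun _ => borel _
  haveI : ∀ γ : Gqs L v, BorelSpace (Gqs L v ⧸ Subgroup.centralizer ({γ} : Set (Gqs L v))) := fun _ => ⟨rfl⟩
  letI : MeasurableSpace ((UnitaryGroup.cmDatum L 2 (Matrix.of fun i j : Fin 2 => if i.val + j.val + 1 = 2 then (1 : L) else 0)).Local v) := borel _
  haveI : BorelSpace ((UnitaryGroup.cmDatum L 2 (Matrix.of fun i j : Fin 2 => if i.val + j.val + 1 = 2 then (1 : L) else 0)).Local v) := ⟨rfl⟩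
  -- the place above `v`
  obtain ⟨w, hw⟩ : ∃ w : PlacesOver L v, IsCMField.complexConj L • w.1 = w.1 := let ⟨w⟩ := PlacesOver.nonempty L v; ⟨w, hns w⟩
  -- ★ S1 CHAR-FIELD: the character family (choice under §1.6)
  obtain ⟨char₀, hchar₀, -⟩ := F0P3cStCharTSCharField.exists_charFamily_charRegularity_Gqs L v hHC w hw (H' := ((UnitaryGroup.cmDatum L 2 (Matrix.of fun i j : Fin 2 => if i.val + j.val + 1 = 2 then (1 : L) else 0)).Local v × (UnitaryGroup.cmDatum L 1 (Matrix.of fun i j : Fin 1 => if i.val + j.val + 1 = 1 then (1 : L) else 0)).Local v)) νQv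
  -- ★ DG-FIELD: `D_G` by its closed formula; ★ DG-FIELD-TWO: `D_H = dg₂ ∘ pr₁` by the rank-2 closed formula and its two letters
  obtain ⟨DG₀, hDG₀⟩ : ∃ f : (Gqs L v) → ℝ, ∀ g : (Gqs L v), f g = ((NNReal.sqrt (NNReal.sqrt ((∏ w : PlacesOver L v, IsNonarchimedeanLocalField.normAbs (w.1.adicCompletion L) (((g.val : GL (Fin 3) (UnitaryGroup.LocalRing L v)).val.charpoly.discr) w)) * ((∏ w : PlacesOver L v, IsNonarchimedeanLocalField.normAbs (w.1.adicCompletion L) (((g.val : GL (Fin 3) (UnitaryGroup.LocalRing L v)).val.det) w)) ^ 2)⁻¹)) : ℝ≥0) : ℝ) := ⟨_, fun g => rfl⟩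
  obtain ⟨DG₂, hDG₂m, hDG₂0, hDG₂u⟩ := F0P3cStCharTSDGFieldTwo.exists_DG_field_two L v (Matrix.of fun i j : Fin 2 => if i.val + j.val + 1 = 2 then (1 : L) else 0)
  -- ★ ST-PIN: `stG`, `detG` (and the scalar ∕ determinant homomorphisms into the centre)
  obtain ⟨ιZ, detZ, detG₀, stG₀, hιc, hdetZc, hιval, hdetZval, hStψ, hStD⟩ := F0P3cStCharTSStPin.exists_stDetFields L v hns μZ
  -- ★ KEYS-FIELDS ∕ XI-DICT ∕ XI-SURJ ∕ KEYS-PAIRS: `pi2`, `piN` with their Keys labels and the pair clause (f)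
  obtain ⟨pi2₀, piN₀, hL2₀, hlabF₀, -, -, hlab₀, hpairs₀⟩ := F0P3cStCharTSXiSurj.exists_keysFields_Hv_pairs μ hμω v hns μZ
  -- ★ H-FIELDS-HCB: `χ_{St_H} = Θ` with its HC bound and the (M1H) clause
  obtain ⟨Θ, ⟨hΘm, hΘli, hΘlc, hΘtr⟩, hΘB, hM1H₀⟩ := F0P3cStCharTSHFieldsHcb.exists_charSt_packetCharHRegularity_hcb L v hHC hHCB w hw νHv _ _
    (F0P3cStCharTSHFields.continuous_psi_comp_localDet L v ξ.ψ) π₁ πSt hlab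
  -- ★ PAR-FIELD-W: the W-normalised parameter map
  obtain ⟨par, hNL₀, hPSpar, hW₀⟩ := F0P3cStCharTSParFieldW.exists_parField_W L v hns μZ
  -- ★ WITNESS: the datum with these fields
  obtain ⟨𝔇, hμG, hμH, hμGZ, horb, hregG, hTr, hmem, hellG, hcharE, hcharHE, hupE, hDGE, hDHE, -, -, hAllE, hcartanGE, hcartanHE,
      hμTE, hμTHE, hstGE, hdetGE, hpi2E, hpiNE, hsqE, hldsE, hirrE, hirrE', -, hstConjHE, hregHE, hellHE⟩ :=
    F0P3cStCharTSDatumWitness.exists_datum_with_fields L μ v νHv νQv μZ mHv mQv πSt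
      (1 : ((UnitaryGroup.cmDatum L 2 (Matrix.of fun i j : Fin 2 => if i.val + j.val + 1 = 2 then (1 : L) else 0)).Local v × (UnitaryGroup.cmDatum L 1 (Matrix.of fun i j : Fin 1 => if i.val + j.val + 1 = 1 then (1 : L) else 0)).Local v) →* (Gqs L v)) (fun _ _ => True) (fun a b : ((UnitaryGroup.cmDatum L 2 (Matrix.of fun i j : Fin 2 => if i.val + j.val + 1 = 2 then (1 : L) else 0)).Local v × (UnitaryGroup.cmDatum L 1 (Matrix.of fun i j : Fin 1 => if i.val + j.val + 1 = 1 then (1 : L) else 0)).Local v) => IsLocalStablyConjH L v a b)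
      {a : ((UnitaryGroup.cmDatum L 2 (Matrix.of fun i j : Fin 2 => if i.val + j.val + 1 = 2 then (1 : L) else 0)).Local v × (UnitaryGroup.cmDatum L 1 (Matrix.of fun i j : Fin 1 => if i.val + j.val + 1 = 1 then (1 : L) else 0)).Local v) | IsLocalGRegular L v a}
      {a : ((UnitaryGroup.cmDatum L 2 (Matrix.of fun i j : Fin 2 => if i.val + j.val + 1 = 2 then (1 : L) else 0)).Local v × (UnitaryGroup.cmDatum L 1 (Matrix.of fun i j : Fin 1 => if i.val + j.val + 1 = 1 then (1 : L) else 0)).Local v) | IsLocalGRegular L v a ∧ IsCompact ((Subgroup.centralizer ({a} : Set ((UnitaryGroup.cmDatum L 2 (Matrix.of fun i j : Fin 2 => if i.val + j.val + 1 = 2 then (1 : L) else 0)).Local v × (UnitaryGroup.cmDatum L 1 (Matrix.of fun i j : Fin 1 => if i.val + j.val + 1 = 1 then (1 : L) else 0)).Local v)) : Subgroup ((UnitaryGroup.cmDatum L 2 (Matrix.of fun i j : Fin 2 => if i.val + j.val + 1 = 2 then (1 : L) else 0)).Local v × (UnitaryGroup.cmDatum L 1 (Matrix.of fun i j : Fin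 1 => if i.val + j.val + 1 = 1 then (1 : L) else 0)).Local v)) : Set ((UnitaryGroup.cmDatum L 2 (Matrix.of fun i j : Fin 2 => if i.val + j.val + 1 = 2 then (1 : L) else 0)).Local v × (UnitaryGroup.cmDatum L 1 (Matrix.of fun i j : Fin 1 => if i.val + j.val + 1 = 1 then (1 : L) else 0)).Local v))}
      Sell SH DG₀ (fun h : ((UnitaryGroup.cmDatum L 2 (Matrix.of fun i j : Fin 2 => if i.val + j.val + 1 = 2 then (1 : L) else 0)).Local v × (UnitaryGroup.cmDatum L 1 (Matrix.of fun i j : Fin 1 => if i.val + j.val + 1 = 1 then (1 : L) else 0)).Local v) => DG₂ h.1) (fun h : ((UnitaryGroup.cmDatum L 2 (Matrix.of fun i j : Fin 2 => if i.val + j.val + 1 = 2 then (1 : L) else 0)).Local v × (UnitaryGroup.cmDatum L 1 (Matrix.of fun i j : Fin 1 => if i.val + j.val + 1 = 1 then (1 : L) else 0)).Local v) => finTau L v h μ) μTf μTHf char₀ (fun _ => Θ)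
      (fun (α : ((UnitaryGroup.cmDatum L 2 (Matrix.of fun i j : Fin 2 => if i.val + j.val + 1 = 2 then (1 : L) else 0)).Local v × (UnitaryGroup.cmDatum L 1 (Matrix.of fun i j : Fin 1 => if i.val + j.val + 1 = 1 then (1 : L) else 0)).Local v) → ℂ) (x : (Gqs L v)) => if IsRegularElt (x.val : GL (Fin 3) (UnitaryGroup.LocalRing L v)) then ((DG₀ x : ℂ))⁻¹ * ∑ᶠ q : Quot (IsLocalStablyConjH L v), (if IsLocalGRegular L v q.out ∧ IsLocalNormPair L (qsForm L) v q.out x then finTau L v q.out μ * (((fun h : ((UnitaryGroup.cmDatum L 2 (Matrix.of fun i j : Fin 2 => if i.val + j.val + 1 = 2 then (1 : L) else 0)).Local v × (UnitaryGroup.cmDatum L 1 (Matrix.of fun i j : Fin 1 => if i.val + j.val + 1 = 1 then (1 : L) else 0)).Local v) => DG₂ h.1) q.out : ℝ) : ℂ) * ((finKappaAt L v (qsForm L) q.out x : ℤ) : ℂ) * α q.out else 0) else 0)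
      stG₀ detG₀ pi2₀ piN₀
  -- the pins at the datum
  have hDGf : ∀ g : (Gqs L v), 𝔇.DG g = ((NNReal.sqrt (NNReal.sqrt ((∏ w : PlacesOver L v, IsNonarchimedeanLocalField.normAbs (w.1.adicCompletion L) (((g.val : GL (Fin 3) (UnitaryGroup.LocalRing L v)).val.charpoly.discr) w)) * ((∏ w : PlacesOver L v, IsNonarchimedeanLocalField.normAbs (w.1.adicCompletion L) (((g.val : GL (Fin 3) (UnitaryGroup.LocalRing L v)).val.det) w)) ^ 2)⁻¹)) : ℝ≥0) : ℝ) := fun g => by rw [hDGE]; exact hDG₀ g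
  have hSq : 𝔇.sqPacketsH = {({πSt} : Finset (IrrClass ((UnitaryGroup.cmDatum L 2 (Matrix.of fun i j : Fin 2 => if i.val + j.val + 1 = 2 then (1 : L) else 0)).Local v × (UnitaryGroup.cmDatum L 1 (Matrix.of fun i j : Fin 1 => if i.val + j.val + 1 = 1 then (1 : L) else 0)).Local v)))} := hsqE
  have hBnd : ∀ C : Set ((UnitaryGroup.cmDatum L 2 (Matrix.of fun i j : Fin 2 => if i.val + j.val + 1 = 2 then (1 : L) else 0)).Local v × (UnitaryGroup.cmDatum L 1 (Matrix.of fun i j : Fin 1 => if i.val + j.val + 1 = 1 then (1 : L) else 0)).Local v), IsCompact C → ∃ B : ℝ, ∀ s ∈ C, ‖(𝔇.DH s : ℂ) * 𝔇.charH πSt s‖ ≤ B := fun C hC => by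
    rw [hDHE, hcharHE]; exact hΘB DG₂ hDG₂0 hDG₂u C hC
  have hSD := hStD 𝔇 hstGE hdetGE hμGZ
  have hM1H : 𝔇.PacketCharHRegularity := hM1H₀ 𝔇 hμH (by rw [hcharHE]) (fun a => by rw [hregHE]; exact Iff.rfl)
    (fun a => by rw [hellHE]; exact Iff.rfl) hSq (by rw [hstConjHE, hregHE]; exact F0P3cStCharTSHstabHolds.hstab_holds L v hns νHv ξ π₁ πSt hlab hπ₁ Θ ⟨hΘm, hΘli, hΘlc, hΘtr⟩)
  have a_hC01 : 𝔇.μG = νQv := hμG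
  have a_hC02 : 𝔇.μH = νHv := hμH
  have a_hC03 : 𝔇.μGZ = μZ := hμGZ
  have a_hC04 : 𝔇.orb = mQv := horb
  have a_hC05 : (∀ γ : Gqs L v, γ ∈ 𝔇.regG ↔ IsRegularElt (γ.val : GL (Fin 3) (UnitaryGroup.LocalRing L v))) := hregG
  have a_hC06 : (∀ (φ : Gqs L v → ℂ) (fH : ((UnitaryGroup.cmDatum L 2 (Matrix.of fun i j : Fin 2 => if i.val + j.val + 1 = 2 then (1 : L) else 0)).Local v × (UnitaryGroup.cmDatum L 1 (Matrix.of fun i j : Fin 1 => if i.val + j.val + 1 = 1 then (1 : L) else 0)).Local v) → ℂ), 𝔇.IsTransfer φ fH ↔ IsLocalDeltaTransfer L (qsForm L) v ((finExplicitCollection L (qsForm L) μ (finExplicitDelta_conj_left_all L (qsForm L) μ) (finExplicitDelta_conj_right_all L (qsForm L) μ)) v) mHv mQv fH φ) := hTr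
  have a_hC07 : ({πSt} : Finset (IrrClass (((UnitaryGroup.cmDatum L 2 (Matrix.of fun i j : Fin 2 => if i.val + j.val + 1 = 2 then (1 : L) else 0)).Local v × (UnitaryGroup.cmDatum L 1 (Matrix.of fun i j : Fin 1 => if i.val + j.val + 1 = 1 then (1 : L) else 0)).Local v)))) ∈ 𝔇.sqPacketsH := hmem
  have a_hE : (∀ γ : Gqs L v, γ ∈ 𝔇.ellG ↔ IsRegularElt (γ.val : GL (Fin 3) (UnitaryGroup.LocalRing L v)) ∧ γ ∉ hyperbolicSet L v) := hellG
  have a_hchar : (∀ π : IrrClass (Gqs L v), Measurable (𝔇.char π) ∧ LocallyIntegrable (𝔇.char π) 𝔇.μG ∧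
          (∀ x ∈ 𝔇.regG, ∀ᶠ y in 𝓝 x, 𝔇.char π y = 𝔇.char π x) ∧
          ∀ φ : Gqs L v → ℂ, IsLocSmooth φ → π.smoothTrace 𝔇.μG φ = ∫ x, φ x * 𝔇.char π x ∂𝔇.μG) := (fun π => by rw [hcharE, hμG]; obtain ⟨h1, h2, h3, h4⟩ := hchar₀ π; exact ⟨h1, h2, fun x hx => h3 x ((hregG x).1 hx), h4⟩)
  have a_hAll : (∀ T : Subgroup (Gqs L v), T ∈ 𝔇.cartanAll ↔ T = (cmBorelTriple L 3 v).M ∨ T ∈ 𝔇.cartanG) := hAllE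
  have a_hHaar : (𝔇.μT (cmBorelTriple L 3 v).M).IsHaarMeasure := (by rw [hμTE]; exact hHaarMO)
  have a_hcart : (∀ T ∈ 𝔇.cartanG, IsCompact (T : Set (Gqs L v)) ∧ ∃ γ₀ : Gqs L v, IsRegularElt (γ₀.val : GL (Fin 3) (UnitaryGroup.LocalRing L v)) ∧ T = Subgroup.centralizer ({γ₀} : Set (Gqs L v))) := (by rw [hcartanGE]; exact hcartO)
  have a_hHaarG : (∀ T ∈ 𝔇.cartanG, (𝔇.μT T).IsHaarMeasure) := (fun T' hT' => by rw [hμTE]; rw [hcartanGE] at hT'; exact hHaarGO T' hT')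
  have a_hfinG : (∀ T ∈ 𝔇.cartanG, IsFiniteMeasure (𝔇.μT T)) := (F0P3cStCharTSCartanNullDischarge.isFiniteMeasure_of_compact_haar L v 𝔇 a_hcart a_hHaarG)
  have a_hker : (∀ T ∈ 𝔇.cartanG, ∃ s : Finset (Subgroup ↥T), (∀ K ∈ s, IsClosed (K : Set ↥T) ∧ ¬ IsOpen (K : Set ↥T)) ∧ ∀ t : ↥T, ¬ IsRegularElt ((t : Gqs L v).val : GL (Fin 3) (UnitaryGroup.LocalRing L v)) → ∃ K ∈ s, t ∈ K) := (F0P3cStCharTSCartanNullDischarge.rootKernels_of_compact_centralizers L v hns 𝔇 a_hcart)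
  have a_eDG : (∀ g : Gqs L v, 𝔇.DG g = ((NNReal.sqrt (NNReal.sqrt ((∏ w : PlacesOver L v, IsNonarchimedeanLocalField.normAbs (w.1.adicCompletion L) (((g.val : GL (Fin 3) (UnitaryGroup.LocalRing L v)).val.charpoly.discr) w)) * ((∏ w : PlacesOver L v, IsNonarchimedeanLocalField.normAbs (w.1.adicCompletion L) (((g.val : GL (Fin 3) (UnitaryGroup.LocalRing L v)).val.det) w)) ^ 2)⁻¹)) : ℝ≥0) : ℝ)) := hDGf
  have a_eDH : (∀ s : ((UnitaryGroup.cmDatum L 2 (Matrix.of fun i j : Fin 2 => if i.val + j.val + 1 = 2 then (1 : L) else 0)).Local v × (UnitaryGroup.cmDatum L 1 (Matrix.of fun i j : Fin 1 => if i.val + j.val + 1 = 1 then (1 : L) else 0)).Local v), 𝔇.DH s = ((NNReal.sqrt (NNReal.sqrt ((∏ w : PlacesOver L v, IsNonarchimedeanLocalField.normAbs (w.1.adicCompletion L) (((s.1.val : GL (Fin 2) (UnitaryGroup.LocalRing L v)).val.charpoly.discr) w)) * (∏ w : PlacesOver L v, IsNonarchimedeanLocalField.normAbs (w.1.adicCompletion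 L) (((s.1.val : GL (Fin 2) (UnitaryGroup.LocalRing L v)).val.det) w))⁻¹)) : ℝ≥0) : ℝ)) := (fun s => by rw [hDHE]; exact F0P3cStCharTSDHLc.DG₂_eq_dgFormulaTwo L v DG₂ hDG₂0 hDG₂u s.1)
  have a_hKH : (∀ T ∈ 𝔇.cartanH, IsCompact (T : Set ((UnitaryGroup.cmDatum L 2 (Matrix.of fun i j : Fin 2 => if i.val + j.val + 1 = 2 then (1 : L) else 0)).Local v × (UnitaryGroup.cmDatum L 1 (Matrix.of fun i j : Fin 1 => if i.val + j.val + 1 = 1 then (1 : L) else 0)).Local v))) := (by rw [hcartanHE]; exact fun T' hT' => (hKHO T' hT').1)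
  have a_hFH : (∀ T ∈ 𝔇.cartanH, IsFiniteMeasure (𝔇.μTH T)) := (fun T' hT' => by rw [hμTHE]; rw [hcartanHE] at hT'; haveI := hHaarHO T' hT'; haveI : CompactSpace ↥T' := isCompact_iff_compactSpace.1 (hKHO T' hT').1; infer_instance)
  have a_hHBH : (∀ ρ ∈ 𝔇.sqPacketsH, ∀ T ∈ 𝔇.cartanH, ∀ C : Set ((UnitaryGroup.cmDatum L 2 (Matrix.of fun i j : Fin 2 => if i.val + j.val + 1 = 2 then (1 : L) else 0)).Local v × (UnitaryGroup.cmDatum L 1 (Matrix.of fun i j : Fin 1 => if i.val + j.val + 1 = 1 then (1 : L) else 0)).Local v), IsCompact C → C ⊆ (T : Set ((UnitaryGroup.cmDatum L 2 (Matrix.of fun i j : Fin 2 => if i.val + j.val + 1 = 2 then (1 : L) else 0)).Local v × (UnitaryGroup.cmDatum L 1 (Matrix.of fun i j : Fin 1 => if i.val + j.val + 1 = 1 then (1 : L) else 0)).Local v)) → ∃ B : ℝ, ∀ γ ∈ C, ‖(𝔇.DH γ : ℂ) * 𝔇.packetCharH ρ γ‖ ≤ B) := (F0P3cStCharTSHcbH.hHBH_cartanH_of_compactBound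 𝔇 πSt hSq hBnd)
  have a_hNL : (∀ π : IrrClass (Gqs L v), ¬ π.IsSquareIntegrable μZ → π.IsConstituentOf (UnitaryGroup.cmPrincipalSeries L 3 v (UnitaryGroup.cmTorusCharPair L v (par π).1 (par π).2)) ∧ Continuous (par π).1 ∧ Continuous (par π).2) := hNL₀
  have a_hPSpar : (∀ π : IrrClass (Gqs L v), (∃ (χ₁ : (UnitaryGroup.LocalRing L v)ˣ →* ℂˣ) (χ₂ : ↥(normOneUnits (conjLocal L (IsCMField.complexConj L) v)) →* ℂˣ), Continuous (fun x => ((χ₁ x : ℂˣ) : ℂ)) ∧ Continuous (fun x => ((χ₂ x : ℂˣ) : ℂ)) ∧ (UnitaryGroup.cmPrincipalSeries L 3 v (UnitaryGroup.cmTorusCharPair L v χ₁ χ₂)).IsIrreducible ∧ π.IsConstituentOf (UnitaryGroup.cmPrincipalSeries L 3 v (UnitaryGroup.cmTorusCharPair L v χ₁ χ₂))) → (UnitaryGroup.cmPrincipalSeries L 3 v (UnitaryGroup.cmTorusCharPair L v (par π).1 (par π).2)).IsIrreducible ∧ π.IsConstituentOf (UnitaryGroup.cmPrincipalSeries L 3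 v (UnitaryGroup.cmTorusCharPair L v (par π).1 (par π).2)) ∧ Continuous (par π).1 ∧ Continuous (par π).2 ∧ Continuous (fun x => (((par π).1 x : ℂˣ) : ℂ)) ∧ Continuous (fun x => (((par π).2 x : ℂˣ) : ℂ)) ∧ ∀ (ν : Measure (Gqs L v)) (f : Gqs L v → ℂ), π.smoothTrace ν f = Representation.smoothTrace (G := Gqs L v) (UnitaryGroup.cmPrincipalSeries L 3 v (UnitaryGroup.cmTorusCharPair L v (par π).1 (par π).2)) ν f) := hPSpar
  have a_hLdsF : (∀ P : Finset (IrrClass (Gqs L v)), P ∈ 𝔇.ldsPackets ↔ (P.card = 2 ∧ ∃ (χ₁ : (UnitaryGroup.LocalRing L v)ˣ →* ℂˣ) (χ₂ : ↥(normOneUnits (conjLocal L (IsCMField.complexConj L) v)) →* ℂˣ), Continuous (fun x => ((χ₁ x : ℂˣ) : ℂ)) ∧ Continuous (fun x => ((χ₂ x : ℂˣ) : ℂ)) ∧ (∀ a : (UnitaryGroup.LocalRing L v)ˣ, (conjLocal L (IsCMField.complexConj L) v) (a : UnitaryGroup.LocalRing L v) = a → χ₁ a = 1) ∧ χ₁ ≠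 1 ∧ ∀ c : IrrClass (Gqs L v), c ∈ P ↔ c.IsConstituentOf (UnitaryGroup.cmPrincipalSeries L 3 v (UnitaryGroup.cmTorusCharPair L v χ₁ χ₂)))) := hldsE
  have a_hW : (∀ (χ₁ : (UnitaryGroup.LocalRing L v)ˣ →* ℂˣ) (χ₂ : ↥(normOneUnits (conjLocal L (IsCMField.complexConj L) v)) →* ℂˣ), Continuous (fun x => ((χ₁ x : ℂˣ) : ℂ)) → Continuous (fun x => ((χ₂ x : ℂˣ) : ℂ)) → ∀ π π' : IrrClass (Gqs L v), ¬ π.IsSquareIntegrable μZ → ¬ π'.IsSquareIntegrable μZ → π.IsConstituentOf (UnitaryGroup.cmPrincipalSeries L 3 v (UnitaryGroup.cmTorusCharPair L v χ₁ χ₂)) → π'.IsConstituentOf (UnitaryGroup.cmPrincipalSeries L 3 v (UnitaryGroup.cmTorusCharPair L v χ₁ χ₂)) → par π = par π') := hW₀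
  have a_hStH : (∀ a b : ((UnitaryGroup.cmDatum L 2 (Matrix.of fun i j : Fin 2 => if i.val + j.val + 1 = 2 then (1 : L) else 0)).Local v × (UnitaryGroup.cmDatum L 1 (Matrix.of fun i j : Fin 1 => if i.val + j.val + 1 = 1 then (1 : L) else 0)).Local v), 𝔇.stConjH a b ↔ IsLocalStablyConjH L v a b) := (fun a b => by rw [hstConjHE])
  have a_hRegH : (∀ a : ((UnitaryGroup.cmDatum L 2 (Matrix.of fun i j : Fin 2 => if i.val + j.val + 1 = 2 then (1 : L) else 0)).Local v × (UnitaryGroup.cmDatum L 1 (Matrix.of fun i j : Fin 1 => if i.val + j.val + 1 = 1 then (1 : L) else 0)).Local v), IsLocalGRegular L v a → a ∈ 𝔇.regH) := (fun a ha => by rw [hregHE]; exact ha)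
  have a_hUp : (∀ (α : ((UnitaryGroup.cmDatum L 2 (Matrix.of fun i j : Fin 2 => if i.val + j.val + 1 = 2 then (1 : L) else 0)).Local v × (UnitaryGroup.cmDatum L 1 (Matrix.of fun i j : Fin 1 => if i.val + j.val + 1 = 1 then (1 : L) else 0)).Local v) → ℂ) (x : Gqs L v), 𝔇.up α x = if IsRegularElt (x.val : GL (Fin 3) (UnitaryGroup.LocalRing L v)) then ((𝔇.DG x : ℂ))⁻¹ * ∑ᶠ q : Quot (IsLocalStablyConjH L v), (if IsLocalGRegular L v q.out ∧ IsLocalNormPair L (qsForm L) v q.out x then finTau L v q.out μ * (𝔇.DH q.out : ℂ) * ((finKappaAt L v (qsForm L) q.out x : ℤ) : ℂ) * α q.out else 0) else 0) := (fun α x => by rw [hupE, hDGE, hDHE])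
  have a_hHBHP : (∀ ρ ∈ 𝔇.sqPacketsH, ∀ C : Set ((UnitaryGroup.cmDatum L 2 (Matrix.of fun i j : Fin 2 => if i.val + j.val + 1 = 2 then (1 : L) else 0)).Local v × (UnitaryGroup.cmDatum L 1 (Matrix.of fun i j : Fin 1 => if i.val + j.val + 1 = 1 then (1 : L) else 0)).Local v), IsCompact C → ∃ B : ℝ, ∀ s ∈ C, IsLocalGRegular L v s → ‖(𝔇.DH s : ℂ) * 𝔇.packetCharH ρ s‖ ≤ B) := (F0P3cStCharTSHcbH.hHBH_of_compactBound 𝔇 πSt hSq hBnd (IsLocalGRegular L v))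
  have a_hlabels : (∀ ξ' : ((UnitaryGroup.cmDatum L 2 (Matrix.of fun i j : Fin 2 => if i.val + j.val + 1 = 2 then (1 : L) else 0)).Local v × (UnitaryGroup.cmDatum L 1 (Matrix.of fun i j : Fin 1 => if i.val + j.val + 1 = 1 then (1 : L) else 0)).Local v) →* ℂˣ, Continuous ξ' → ∃ (η₁ η₂ : ↥(normOneUnits (conjLocal L (IsCMField.complexConj L) v)) →* ℂˣ), Continuous (fun x => ((η₁ x : ℂˣ) : ℂ)) ∧ Continuous (fun x => ((η₂ x : ℂˣ) : ℂ)) ∧ KeysCaseTwoLabels L v (μ.semilocalComponent L v) η₁ η₂ (𝔇.pi2 ξ') (𝔇.piN ξ')) := (fun ξ' hξ' => by rw [hpi2E, hpiNE]; exact hlab₀ ξ' hξ')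
  have a_hSt : (∀ ψ' : ↥(Subgroup.center (Gqs L v)) →* ℂˣ, Continuous ψ' → ∃ ψ : ↥(normOneUnits (conjLocal L (IsCMField.complexConj L) v)) →* ℂˣ, Continuous ψ ∧ 𝔇.stG ψ' ≠ 𝔇.detG ψ' ∧ ∀ c : IrrClass (Gqs L v), c.IsConstituentOf (UnitaryGroup.cmPrincipalSeries L 3 v (UnitaryGroup.cmTorusCharPair L v (halfModulusChar (UnitaryGroup.LocalRing L v) * halfModulusChar (UnitaryGroup.LocalRing L v))⁻¹ ψ)) ↔ (c = 𝔇.stG ψ' ∨ c = 𝔇.detG ψ')) := (fun ψ' hψ' => by rw [hstGE, hdetGE]; obtain ⟨-, h2, h3, -, -, -, -⟩ := hStψ ψ' hψ'; exact ⟨ψ'.comp ιZ, hψ'.comp hιc, h2, h3⟩)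
  have a_hStJH : (∀ ψ₀ : ↥(normOneUnits (conjLocal L (IsCMField.complexConj L) v)) →* ℂˣ, Continuous (fun x => ((ψ₀ x : ℂˣ) : ℂ)) → ∃ ψ : ↥(Subgroup.center (Gqs L v)) →* ℂˣ, Continuous ψ ∧ ∀ c : IrrClass (Gqs L v), c.IsConstituentOf (UnitaryGroup.cmPrincipalSeries L 3 v (UnitaryGroup.cmTorusCharPair L v (halfModulusChar (UnitaryGroup.LocalRing L v) * halfModulusChar (UnitaryGroup.LocalRing L v))⁻¹ ψ₀)) ↔ (c = 𝔇.stG ψ ∨ c = 𝔇.detG ψ)) := (F0P3cStCharTSStJH.stJH_datum L v hns ιZ hιc hιval stG₀ detG₀ (fun ψ hψ => (hStψ ψ hψ).2.2.1) 𝔇 hstGE hdetGE)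
  have a_hKeysJH : (∀ (η₁ η₂ : ↥(normOneUnits (conjLocal L (IsCMField.complexConj L) v)) →* ℂˣ), Continuous (fun x => ((η₁ x : ℂˣ) : ℂ)) → Continuous (fun x => ((η₂ x : ℂˣ) : ℂ)) → ∃ ξ' : ((UnitaryGroup.cmDatum L 2 (Matrix.of fun i j : Fin 2 => if i.val + j.val + 1 = 2 then (1 : L) else 0)).Local v × (UnitaryGroup.cmDatum L 1 (Matrix.of fun i j : Fin 1 => if i.val + j.val + 1 = 1 then (1 : L) else 0)).Local v) →* ℂˣ, Continuous ξ' ∧ KeysCaseTwoLabels L v (μ.semilocalComponent L v) η₁ η₂ (𝔇.pi2 ξ') (𝔇.piN ξ')) := (fun η₁ η₂ h1 h2 => by rw [hpi2E, hpiNE]; exact hpairs₀ η₁ η₂ h1 h2)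
  have a_hM1lc : (∀ ρ ∈ 𝔇.sqPacketsH, ∀ a : ((UnitaryGroup.cmDatum L 2 (Matrix.of fun i j : Fin 2 => if i.val + j.val + 1 = 2 then (1 : L) else 0)).Local v × (UnitaryGroup.cmDatum L 1 (Matrix.of fun i j : Fin 1 => if i.val + j.val + 1 = 1 then (1 : L) else 0)).Local v), IsLocalGRegular L v a → ∀ᶠ a' in 𝓝 a, 𝔇.packetCharH ρ a' = 𝔇.packetCharH ρ a) := (fun ρ hρ a ha => by rw [hSq, Set.mem_singleton_iff] at hρ; subst hρ; have e : 𝔇.packetCharH {πSt} = Θ := funext fun h => (by simp only [Ch12Sec5.EllipticData.packetCharH, Finset.sum_singleton, hcharHE]); rw [e]; exact hΘlc a ha)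
  have a_hcovA : (∀ γ : Gqs L v, IsRegularElt (γ.val : GL (Fin 3) (UnitaryGroup.LocalRing L v)) → ∃ T' ∈ 𝔇.cartanAll, ∃ x : Gqs L v, ∀ g : Gqs L v, g ∈ Subgroup.centralizer ({γ} : Set (Gqs L v)) ↔ x⁻¹ * g * x ∈ T') := (fun γ hγ => by obtain ⟨T', hT', x, hx⟩ := hcovGO γ hγ; exact ⟨T', (hAllE T').2 (by rw [hcartanGE]; exact Finset.mem_insert.1 hT'), x, hx⟩)
  have a_hncA : (∀ T' ∈ 𝔇.cartanAll, ∀ T'' ∈ 𝔇.cartanAll, T' ≠ T'' → ∀ y : Gqs L v, ¬ ∀ h : Gqs L v, h ∈ T'' ↔ y⁻¹ * h * y ∈ T') := (fun T' hT' T'' hT'' hne => hncGO T' (by have h1 := (hAllE T').1 hT'; rw [hcartanGE] at h1; exact Finset.mem_insert.2 h1) T'' (by have h2 := (hAllE T'').1 hT''; rw [hcartanGE] at h2; exact Finset.mem_insert.2 h2) hne)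
  have a_hcptA : (∀ T' ∈ 𝔇.cartanAll, T' ≠ (cmBorelTriple L 3 v).M → IsCompact (T' : Set (Gqs L v))) := (fun T' hT' hne => by rcases (hAllE T').1 hT' with h | h; exacts [absurd h hne, (hcartO T' (hcartanGE ▸ h)).1])
  have a_hinvT : (∀ T' ∈ 𝔇.cartanAll, (𝔇.μT T').IsInvInvariant) := (fun T' hT' => by rw [hμTE]; rcases (hAllE T').1 hT' with h | h; exacts [h ▸ hinvMO, hinvGO T' (hcartanGE ▸ h)])
  have a_hcoreT : (∀ T' ∈ 𝔇.cartanAll, 𝔇.μT T' (compactCore ↥T') = 1) := (fun T' hT' => by rw [hμTE]; rcases (hAllE T').1 hT' with h | h; exacts [h ▸ hcoreMO, hcoreGO T' (hcartanGE ▸ h)])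
  have a_hIrr : (∀ π ∈ 𝔇.irredPS, ∃ (χ₁ : (UnitaryGroup.LocalRing L v)ˣ →* ℂˣ) (χ₂ : ↥(normOneUnits (conjLocal L (IsCMField.complexConj L) v)) →* ℂˣ), Continuous (fun x => ((χ₁ x : ℂˣ) : ℂ)) ∧ Continuous (fun x => ((χ₂ x : ℂˣ) : ℂ)) ∧ (UnitaryGroup.cmPrincipalSeries L 3 v (UnitaryGroup.cmTorusCharPair L v χ₁ χ₂)).IsIrreducible ∧ π.IsConstituentOf (UnitaryGroup.cmPrincipalSeries L 3 v (UnitaryGroup.cmTorusCharPair L v χ₁ χ₂))) := hirrE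
  have a_hKeys : (∀ ξ' : ((UnitaryGroup.cmDatum L 2 (Matrix.of fun i j : Fin 2 => if i.val + j.val + 1 = 2 then (1 : L) else 0)).Local v × (UnitaryGroup.cmDatum L 1 (Matrix.of fun i j : Fin 1 => if i.val + j.val + 1 = 1 then (1 : L) else 0)).Local v) →* ℂˣ, (𝔇.pi2 ξ').IsSquareIntegrable 𝔇.μGZ ∧ ¬ (𝔇.piN ξ').IsSquareIntegrable 𝔇.μGZ) := (fun ξ' => by rw [hpi2E, hpiNE, hμGZ]; exact hL2₀ ξ')
  have a_hDet : 𝔇.DetNotL2 := hSD.2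
  have a_hM1H : 𝔇.PacketCharHRegularity := hM1H
  have a_hStL2 : (∀ ψ' : ↥(Subgroup.center (Gqs L v)) →* ℂˣ, Continuous ψ' → 𝔇.IsL2 (𝔇.stG ψ')) := hSD.1
  have a_eCartanG : 𝔇.cartanG = Sell := hcartanGE
  have a_eMuT : (∀ T' : Subgroup (Gqs L v), 𝔇.μT T' = μTf T') := hμTE
  have a_eCartanH : 𝔇.cartanH = SH := hcartanHE
  have a_eMuTH : (∀ T' : Subgroup ((UnitaryGroup.cmDatum L 2 (Matrix.of fun i j : Fin 2 => if i.val + j.val + 1 = 2 then (1 : L) else 0)).Local v × (UnitaryGroup.cmDatum L 1 (Matrix.of fun i j : Fin 1 => if i.val + j.val + 1 = 1 then (1 : L) else 0)).Local v), 𝔇.μTH T' = μTHf T') := hμTHE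
  have a_eRegH : (∀ a : ((UnitaryGroup.cmDatum L 2 (Matrix.of fun i j : Fin 2 => if i.val + j.val + 1 = 2 then (1 : L) else 0)).Local v × (UnitaryGroup.cmDatum L 1 (Matrix.of fun i j : Fin 1 => if i.val + j.val + 1 = 1 then (1 : L) else 0)).Local v), a ∈ 𝔇.regH ↔ IsLocalGRegular L v a) := (fun a => by rw [hregHE]; exact Iff.rfl)
  have a_eEllH : (∀ a : ((UnitaryGroup.cmDatum L 2 (Matrix.of fun i j : Fin 2 => if i.val + j.val + 1 = 2 then (1 : L) else 0)).Local v × (UnitaryGroup.cmDatum L 1 (Matrix.of fun i j : Fin 1 => if i.val + j.val + 1 = 1 then (1 : L) else 0)).Local v), a ∈ 𝔇.ellH ↔ IsLocalGRegular L v a ∧ IsCompact ((Subgroup.centralizer ({a} : Set ((UnitaryGroup.cmDatum L 2 (Matrix.of fun i j : Fin 2 => if i.val + j.val + 1 = 2 then (1 : L) else 0)).Local v × (UnitaryGroup.cmDatum L 1 (Matrix.of fun i j : Fin 1 => if i.val + j.val + 1 = 1 then (1 : L) else 0)).Local v)) : Subgroup ((UnitaryGroup.cmDatum L 2 (Matrix.of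 fun i j : Fin 2 => if i.val + j.val + 1 = 2 then (1 : L) else 0)).Local v × (UnitaryGroup.cmDatum L 1 (Matrix.of fun i j : Fin 1 => if i.val + j.val + 1 = 1 then (1 : L) else 0)).Local v)) : Set ((UnitaryGroup.cmDatum L 2 (Matrix.of fun i j : Fin 2 => if i.val + j.val + 1 = 2 then (1 : L) else 0)).Local v × (UnitaryGroup.cmDatum L 1 (Matrix.of fun i j : Fin 1 => if i.val + j.val + 1 = 1 then (1 : L) else 0)).Local v))) := (fun a => by rw [hellHE]; exact Iff.rfl)
  have a_eSq : 𝔇.sqPacketsH = {({πSt} : Finset (IrrClass ((UnitaryGroup.cmDatum L 2 (Matrix.of fun i j : Fin 2 => if i.val + j.val + 1 = 2 then (1 : L) else 0)).Local v × (UnitaryGroup.cmDatum L 1 (Matrix.of fun i j : Fin 1 => if i.val + j.val + 1 = 1 then (1 : L) else 0)).Local v)))} := hSq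
  have a_eIrr : (∀ π : IrrClass (Gqs L v), (∃ (χ₁ : (UnitaryGroup.LocalRing L v)ˣ →* ℂˣ) (χ₂ : ↥(normOneUnits (conjLocal L (IsCMField.complexConj L) v)) →* ℂˣ), Continuous (fun x => ((χ₁ x : ℂˣ) : ℂ)) ∧ Continuous (fun x => ((χ₂ x : ℂˣ) : ℂ)) ∧ (UnitaryGroup.cmPrincipalSeries L 3 v (UnitaryGroup.cmTorusCharPair L v χ₁ χ₂)).IsIrreducible ∧ π.IsConstituentOf (UnitaryGroup.cmPrincipalSeries L 3 v (UnitaryGroup.cmTorusCharPair L v χ₁ χ₂))) → π ∈ 𝔇.irredPS) := hirrE'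
  have a_eLab : (∀ (η₁ η₂ : ↥(normOneUnits (conjLocal L (IsCMField.complexConj L) v)) →* ℂˣ), Continuous (fun x => ((η₁ x : ℂˣ) : ℂ)) → Continuous (fun x => ((η₂ x : ℂˣ) : ℂ)) → ∀ ξ' : ((UnitaryGroup.cmDatum L 2 (Matrix.of fun i j : Fin 2 => if i.val + j.val + 1 = 2 then (1 : L) else 0)).Local v × (UnitaryGroup.cmDatum L 1 (Matrix.of fun i j : Fin 1 => if i.val + j.val + 1 = 1 then (1 : L) else 0)).Local v) →* ℂˣ, (∀ hh : ((UnitaryGroup.cmDatum L 2 (Matrix.of fun i j : Fin 2 => if i.val + j.val + 1 = 2 then (1 : L) else 0)).Local v × (UnitaryGroup.cmDatum L 1 (Matrix.of fun i j : Fin 1 => if i.val + j.val + 1 = 1 then (1 : L) else 0)).Local v), ξ' hh = η₁ (localDet (IsCMField.complexConj L) v (isUnit_antidiagOne_det L 2) hh.1) * η₂ (localDet (IsCMField.complexConj L) v (isUnit_antidiagOne_det L 2) hh.1 * localDet (IsCMField.complexConj L) v (isUnit_antidiagOne_det L 1) hh.2)) → KeysCaseTwoLabels L v (μ.semilocalComponent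 L v) η₁ η₂ (𝔇.pi2 ξ') (𝔇.piN ξ')) := (fun η₁ η₂ h1 h2 ξ' hξ' => by rw [hpi2E, hpiNE]; exact hlabF₀ η₁ η₂ h1 h2 ξ' hξ')
  have a_eCharH : (∀ ρ : IrrClass ((UnitaryGroup.cmDatum L 2 (Matrix.of fun i j : Fin 2 => if i.val + j.val + 1 = 2 then (1 : L) else 0)).Local v × (UnitaryGroup.cmDatum L 1 (Matrix.of fun i j : Fin 1 => if i.val + j.val + 1 = 1 then (1 : L) else 0)).Local v), 𝔇.charH ρ = 𝔇.charH πSt) := (fun ρ => by rw [hcharHE])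
  have a_eSt : (∃ (ιZ : ↥(normOneUnits (conjLocal L (IsCMField.complexConj L) v)) →* ↥(Subgroup.center (Gqs L v))) (detZ : (Gqs L v) →* ↥(Subgroup.center (Gqs L v))), Continuous ιZ ∧ Continuous detZ ∧ (∀ z : ↥(normOneUnits (conjLocal L (IsCMField.complexConj L) v)), ((ιZ z).val.val.val : Matrix (Fin 3) (Fin 3) (UnitaryGroup.LocalRing L v)) = (((z : (UnitaryGroup.LocalRing L v)ˣ) : UnitaryGroup.LocalRing L v)) • (1 : Matrix (Fin 3) (Fin 3) (UnitaryGroup.LocalRing L v))) ∧ (∀ g : (Gqs L v), ((detZ g).val.val.val : Matrix (Fin 3) (Fin 3) (UnitaryGroup.LocalRing L v)) = (g.val.val : Matrix (Fin 3) (Fin 3) (UnitaryGroup.LocalRing L v)).det • (1 : Matrix (Fin 3) (Fin 3) (UnitaryGroup.LocalRing L v))) ∧ ∀ ψ : ↥(Subgroup.center (Gqs L v)) →* ℂˣ, Continuous ψ → (∃ hopen : IsOpen (((ψ.comp detZ).ker : Subgroup (Gqs L v)) : Set (Gqs L v)), 𝔇.detG ψ = IrrClass.mk (SmoothIrrep.ofChar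 (ψ.comp detZ) hopen)) ∧ 𝔇.stG ψ ≠ 𝔇.detG ψ ∧ (∀ c : IrrClass (Gqs L v), c.IsConstituentOf (cmPrincipalSeries L 3 v (cmTorusCharPair L v (halfModulusChar (UnitaryGroup.LocalRing L v) * halfModulusChar (UnitaryGroup.LocalRing L v))⁻¹ (ψ.comp ιZ))) ↔ (c = 𝔇.stG ψ ∨ c = 𝔇.detG ψ)) ∧ (𝔇.stG ψ).IsSquareIntegrable μZ ∧ ¬ (𝔇.detG ψ).IsSquareIntegrable μZ) := ⟨ιZ, detZ, hιc, hdetZc, hιval, hdetZval, fun ψ hψ => by rw [hstGE, hdetGE]; obtain ⟨h1, h2, h3, h4, h5, -, -⟩ := hStψ ψ hψ; exact ⟨h1, h2, h3, h4, h5⟩⟩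
  -- ★ ROAD «M5-H» (F0P3a-p04 (g29) et al.; T14-41): (M5) `PacketCharHNorm` ⟸ ★ (B6)+(M5-a) junction `packetCharHNorm_of_ellipticWeylMass` ∘ ★ (B5) `ellipticWeylMass_H_eq_one` (Kottwitz EP on `H_v` through ★ WIF-H) — at the pins, NO printed input
  have hM5 : 𝔇.PacketCharHNorm := F0P3cStCharTSEllMassHJunction.packetCharHNorm_of_ellipticWeylMass L v hns νHv ξ π₁ πSt hlab hπ₁ SH μTHf hKHO hHaarHO 𝔇 a_hC02 𝔇.DH (fun _ => rfl) a_hM1lc hM1H hcartanHE hμTHE hSq (F0P3cStCharTSEllMassH.ellipticWeylMass_H_eq_one L v hns SH μTHf hKHO hcovHO hncHO hHaarHO hprobHO 𝔇.DH a_eDH)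
  -- ★ ROAD «ELL-INNER» (map owner LH6-p03 (g7); (E0)–(E8) + (E2b) + (E4″) ★; LEAD T14-40∕T14-44): (1252) `Prop1252` ⟸ ★ (E9) dock `prop1252_of_concrete` (F0P2-p01, p852667) ∘ ★ F-head `prop1252_concrete` (F0P3a-p06, p852706) — at the rung-0 Cartan binders and pins, NO printed input
  have h1252 : 𝔇.Prop1252 := F0P3cStCharTSEllInnerDatumDict.prop1252_of_concrete L v μ 𝔇 Sell μTf SH μTHf a_eDG a_eDH a_hStH a_hUp a_eCartanG a_eMuT a_eCartanH a_eMuTH a_eEllH (F0P3cStCharTSEllInnerConcreteHead.prop1252_concrete L v hns μ hμu Sell μTf SH μTHf hcartO hcovGO hncGO hHaarGO hcoreGO hKHO hcovHO hncHO hHaarHO hprobHO)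
  obtain ⟨hPCEnsNWR, hL2oneNsNWR, h61bNsEPR, hLdsOneR, hR0, hPosOneNsNW⟩ := hBlock 𝔇 par a_hC01 a_hC02 a_hC03 a_hC04 a_hC05 a_hC06 a_hC07 a_hE a_hchar a_hAll a_hHaar a_hcart a_hHaarG a_hfinG a_hker a_eDG a_eDH a_hKH a_hFH a_hHBH a_hNL a_hPSpar a_hLdsF a_hW a_hStH a_hRegH a_hUp a_hHBHP a_hlabels a_hSt a_hStJH a_hKeysJH a_hM1lc a_hcovA a_hncA a_hcptA a_hinvT a_hcoreT a_hIrr a_hKeys a_hDet a_hM1H a_hStL2 a_eCartanG a_eMuT a_eCartanH a_eMuTH a_eRegH a_eEllH a_eSq a_eIrr a_eLab a_eCharH a_eSt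
  -- ★ OPP-23 at rung 0 (the junction's `hOppcert` term over the pins): characters of a kind-2 pair are opposite on the elliptic set
  have hK20 := F0P3cStCharTSPs2Kind2Datum.ps2_kind2_of_fields hns μZ 𝔇 a_hC03 a_hSt par a_hNL νQv
  have hPS2cert0 := F0P3cStCharTSPs2Assembly.ps2_of_kinds hns (μ.semilocalComponent L v) (isQuadraticCharExtension_semilocalComponent_of_baseChange_eq μ hμω v) (Units.continuous_val.comp (UnitaryGroup.continuous_semilocalComponent L μ)) μZ 𝔇 a_hC03 (F0P3cStCharTSLdsFields.lds_sockets_of_ldsFields hns μZ 𝔇 a_hC03 a_hLdsF).1 a_hStL2 a_hKeys a_hlabels par a_hNL νQv hK20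
  have hOppcert0 := F0P3cStCharTSOpp23.charOpposite_of_PS2 L v hns νQv mQv hcanQ 𝔇 a_hC01 a_hC05 (fun γ hγ => (a_hE γ).1 hγ) (F0P3cStCharTSEllOpen.isOpen_setOf_isRegularElt_and_not_mem_hyperbolicSet L v hns) a_hchar par hPS2cert0 (F0P3cStCharTSParField.parField_sockets 𝔇 μZ νQv par a_hNL a_hPSpar a_hIrr a_hC03).2
  -- ★ «SC-SPLIT» + «EP-SPLIT» at rung 0: the supercuspidal (E2-5b p852902 (P)) and, at an unramified place, the `St_G(ψ)` ((G5) p853007 over (G3) p853021) instances of POS-ONE are theorems at the pins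
  have hPosOne : (∀ π : IrrClass (Gqs L v), 𝔇.IsL2 π → ∃ f : (Gqs L v) → ℂ, 𝔇.IsPseudoCoeff π f ∧ 0 < (f 1).re ∧ (f 1).im = 0) := fun π hL2 => by
    by_cases hsc : π.IsSupercuspidal
    · obtain ⟨f, hf, h1, h2, -, -⟩ := F0P3cStCharTSScPseudoCoeff.exists_isPseudoCoeff_of_isSupercuspidal L v hns νQv mQv hcanQ 𝔇 a_hC01 a_hC04 a_hC05 a_hE a_hchar π hsc
      exact ⟨f, hf, h1, h2⟩
    · by_cases hep : (Algebra.IsUnramifiedIn (𝓞 L) v.asIdeal ∨ Valued.v (2 : v.adicCompletion ↥(maximalRealSubfield L)) = 1) ∧ ∃ ψ : ↥(Subgroup.center (Gqs L v)) →* ℂˣ, Continuous ψ ∧ π = 𝔇.stG ψ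
      · obtain ⟨hunr, ψ, hψ, rfl⟩ := hep
        obtain ⟨ιZ', detZ', -, -, -, -, hStAll⟩ := a_eSt
        obtain ⟨⟨hopen, hdet⟩, -, -, -, hdetL2μ⟩ := hStAll ψ hψ
        have hndet : ¬ 𝔇.IsL2 (𝔇.detG ψ) := by
          show ¬ IrrClass.IsSquareIntegrable 𝔇.μGZ (𝔇.detG ψ)
          rw [a_hC03]; exact hdetL2μ
        have hOpp := hOppcert0 (𝔇.detG ψ) (𝔇.stG ψ) hndet (a_hStL2 ψ hψ) (Or.inr (Or.inl ⟨ψ, hψ, Or.inr ⟨rfl, rfl⟩⟩))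
        have hEP := F0P3cStCharTSEPGlueGNotWild.exists_epFunction_G_of_not_wild L v hns hunr νQv hcanQ
        obtain ⟨f, hf, h1, h2⟩ := F0P3cStCharTSEPPseudoCoeffStLetters.exists_isPseudoCoeff_stG_of_epFunction L v hns νQv mQv 𝔇 a_hC01 a_hC04 a_hC05 a_hE a_hchar hEP ψ detZ' hopen hdet hOpp
        exact ⟨f, hf, h1, h2⟩
      · exact hPosOneNsNW π hL2 hsc hep
  -- ★ «O3 ⟸ POS-ONE» (F0P3a-p02 (g26) p852744, CERT-O3-PosOne-dock 6b8def96): the formal degrees `d` with (PL) and positivity from pseudo-coefficients with `0 < f_π(1)` real, via (GERM-3) at the type-(3) torus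
  obtain ⟨d, hPL, hdpos⟩ := F0P3cStCharTSPcValueAtOne.exists_formalDegree_of_posOne L (qsForm L) v (antidiagOne_isHermitian L 3) (isUnit_antidiagOne_det L 3).ne_zero hcanQ.isAdmissibleOn 𝔇 a_hC04 a_hC05 T (F0P3cStCharTSGermThree.germThree_local_of_germResidue L (qsForm L) v mQv 𝔇 a_hC04 a_hC05 T ((shalikaGermResidueAtTorus_iff L (qsForm L) v mQv T).1 hGerm)) hPosOne
  exact hneg ⟨𝔇, d, T, par, (μ.semilocalComponent L v), a_hC01, a_hC02, a_hC03, a_hC04, a_hC05, a_hC06, a_hC07, a_hE, a_hchar, a_hAll, a_hHaar, a_hcart, a_hHaarG, a_hfinG, a_hker, a_eDG, a_eDH, a_hKH, a_hFH, a_hHBH, a_hNL, a_hPSpar, a_hLdsF, a_hW, (isQuadraticCharExtension_semilocalComponent_of_baseChange_eq μ hμω v), (Units.continuous_val.comp (UnitaryGroup.continuous_semilocalComponent L μ)), a_hStH, a_hRegH, a_hUp, a_hHBHP, ((shalikaGermResidueAtTorus_iff L (qsForm L) v mQv T).1 hGerm), a_hlabels, a_hSt, a_hStJH, a_hKeysJH,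 a_hM1lc, a_hcovA, a_hncA, a_hcptA, a_hinvT, a_hcoreT, a_hIrr, a_hKeys, hT3, a_hDet, hKeysRed, (F0P3cStCharTSLdsTwoOfTwo.ldsTwo_of_ldsReducibleTwo L v hns (F0P3cStCharTSLdsRedTwoOfReducible.ldsRedTwo_of_keysRedThree L v hns (F0P3cStCharTSKeys3AnalyticHalf.hKeysRed3_holds L v hns))), (by rw [show (fun x : Gqs L v => (𝔇.DG x)⁻¹) = (fun g : (Gqs L v) => (((NNReal.sqrt (NNReal.sqrt ((∏ w : PlacesOver L v, IsNonarchimedeanLocalField.normAbs (w.1.adicCompletion L) (((g.val : GL (Fin 3) (UnitaryGroup.LocalRing L v)).val.charpoly.discr) w)) * ((∏ w : PlacesOver L v, IsNonarchimedeanLocalField.normAbs (w.1.adicCompletion L) (((g.val : GL (Fin 3) (UnitaryGroup.LocalRing L v)).val.det) w)) ^ 2)⁻¹)) : ℝ≥0) : ℝ))⁻¹) from funext fun g => by rw [hDGf], hμG]; exact F0P3cStCharTSWeylDiscrLocInt.locallyIntegrable_weylDiscr_inv L v hns νQv), h1252, hPCEnsNWR, hL2oneNsNWR, h61bNsEPR,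 hLdsOneR, a_hM1H, hM5, hR0, a_hStL2, hPL, hdpos, hHCB, a_eIrr, a_eSt, a_eRegH⟩

end Summit.HodgeConjecture.HodgeConjecture.Cruxes.H413.F0P3cStCharTSRung0TwentyTwo

end
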